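import Literature.MathematicalPhysics.QuantumFieldTheory.Balaban1983to89.B1Eq323DisplayedCumulantBound
import Literature.MathematicalPhysics.QuantumFieldTheory.Balaban1983to89.B1Props21to23RegularTorus
import Literature.MathematicalPhysics.QuantumFieldTheory.Balaban1983to89.B2Eq230CondShiftBound

/-!
# `Balaban1983to89.B1Eq323DisplayedCumulantBoundModels` — T. Bałaban, *(Higgs)₂,₃ quantum fields in a finite volume. I. A lower bound*,
Commun. Math. Phys. **85** (1982) 603–626 [Balaban1982Higgs1], (3.23) p. 616 with Prop. 2.3 (2.34) p. 611 and Prop. 3.2 (3.56)–(3.58) p. 622: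
**THE CONNECTED-GRAPH BOUND *"⟨Vⁿ⟩^T = O(ε^κ)|T₁|"* FOR THE DISPLAYED INTERACTION `V^{(k)}` OF (3.57) ON THE MODEL CLASSES OF RECORD, WITH NO
PROPAGATOR HYPOTHESIS** — r14's `B1Eq323DisplayedCumulantBound.abs_cumulantOf_rv357_le_of_ineq234` (p396542) with its two displayed Prop. 2.3 (2.34)
kernel inputs `h234A` / `h234φ` fed BY NAME from the cell's (2.34) instance files (zero background on the whole torus at every level `0 ≤ k < K`;
an `r`-regular background `B^{(1)}` on `T_ε` at the first step `k = 0`; at the levels `1 ≤ k < K` on the cube sub-family: the background `A^{(k),ε}`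
of (3.29), and — Prop. 2.3's own class — a general regular background on `T_ε`); theorems only, no definition, no `Prop`-valued fact.  The twin, for (3.23),
of the typer's `B1Eq324DisplayedInteractionLeafModels` (p395883/p396604) for (3.24)/(3.59).

statement-level skeleton of published theorems with citation tags; proofs where landed; nothing here is a claim about the Yang–Mills mass gap

PDF held: `paper:balaban1982-cmp85-higgs23-i` (journal page = PDF page + 602); pp. 604, 608, 610–611, 616, 622 [PDF 2, 6, 8–9, 14, 20]; the p. 616
quotation below is from the text layer `p0014.txt` l.15–17 checked against the render used by r14 g26 (`B1Eq323DisplayedCumulantBound`) and by the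
typer g33 (`…-p014-x2.png`).

CITATION HEADER (lean-in-tree rule).  lit-balaban typed skeleton (HOME `run/shared/lean/pub/lit-balaban/`), unit `lit-balaban-typer` gen 34
(`literature-prover-lit-balaban-typer-g34-0`; TAKING #2 line HOME/STATUS.md 2026-08-25T09:08Z, free-target protocol G.5-34 (d), window honoured).
SKELETON rows **B1.Eq3.23** / **B1.Eq3.24** (owner r12) and **B1.Eq3.59** (r14, class D `typed p239114`) — CELLS ONLY, no head change; row
**B1.Prop2.3** (r14) consumed.  USED BY NAME, NOTHING RESTATED OR EDITED: r14 g26's `B1Eq323DisplayedCumulantBound.abs_cumulantOf_rv357_le_of_ineq234`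
(p396542), r14 g9's `B1Ineq234ZeroFieldRegionUniform.{ineq234_zeroField_region_levelZero_uniform, ineq234_zeroField_region_uniform, decay_transfer,
profile_anti, kerConst_levelZero_eq, kerConst_levelZero_le}` (p302810 ff.), r14 g7's `B1Ineq234Concrete.{ineq234_concrete, profile}` and
`B1Ineq234LevelZero.hker_precOpA_levelZero`, r14's `B1Ineq233LowerBackgroundTorus.ineq233_lower_regular_torus_levelZero`, r14 g13's
`B1Ineq234BackgroundTorus.{two_le_sitesPerDir, ineq234_236_bgVec_torus}` (p318167) and `B1Props21to23RegularTorus.ineq234_236_regular_torus`,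
p23/r15's `B1Eq31Concrete.bgVec`, `B1Eq324SmallFieldLeaf.{siteDelta, bondDelta, siteInner_siteDelta}`, the typer g7's
`B2Eq230CondShiftBound.norm_kernel_le_of_abs_mat_le` (entrywise ⇒ operator norm of a kernel block), p35's `B1Eq230FluctCov.{mat, cb, fluctCovA_zero_field}`,
the typer's `HiggsCondCov232.condCov232_univ` and `B1Eq357FluctuationPolynomial.{law356, rv357}`, pv09's `B4Sect5Torus.{cSt, dSt}`, p15's
`B2Prop31ZeroFieldConcrete.gamma0`, r14's `B1Eq323ConnectedGraphBound.connConst`.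

WHAT IS PRINTED (verbatim, p. 616 [PDF 14]): *"The coefficients of the polynomial V are proportional to some positive powers of ε. The smallest such
power is ε^{1/2} and ⟨Vⁿ⟩^T is the expression corresponding to the sum of connected graphs with exponentially decaying propagators. Hence ⟨Vⁿ⟩^T =
O(ε^κ)|T₁| with κ > d for n sufficiently large, e.g. n > 6."*  p. 611 [PDF 9]: *"|C^{(k)}_Λ(Ω, A; x, x′)| ≦ c₀exp(−δ₀|x − x′|), x, x′ ∈ Λ. (2.34) In
particular the above inequality holds for C^{(k)}(Ω, A)."*  p. 608 [PDF 6]: *"The renormalization transformations for vector fields will be obtained by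
taking N = d and an external vector field A = 0, so we will not consider them separately"*.

DICTIONARY.  `⟨(V^{(k)})ⁿ⟩^T` ↦ `cumulantOf (nmoment (rv357 k qmax coef) (law356 C Ω B μ₀² m² a k)) n` (the B1.Eq3.59 chain; r14's
`cumulantOf_rv357_eq_ursellOf` identifies it with p33's Ursell function); the *"exponentially decaying propagators"* ↦ r14's hypotheses
`h234A : |⟨δ_b, C^{(k)}δ_{b′}⟩| ≦ c_A(L^kε)^{−(d−2)}e^{−δ₁|b₋−b′₋|}` (vector factor, covariance (2.30) `HiggsFluctMeasure.fluctCov P μ₀² a k`) and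
`h234φ : |⟨δ_{y,j}, C^{(k)}_{T^{(k)}}(Ω,B)δ_{y′,j′}⟩| ≦ c_φ(L^kε)^{−(d−2)}e^{−δ₁|y−y′|}` (scalar factor, `HiggsCondCov232.condCov232 C Ω B m² a k T^{(k)}`), both in
the pairing (1.5) at the point sources `B1Eq324SmallFieldLeaf.{bondDelta, siteDelta}`; the cell's (2.34) instances are ENTRYWISE bounds on p35's
coordinate matrix `mat` in the orthonormal site frame of p. 605 (`B1Eq221Coordinates`, Mathlib's `stdOrthonormalBasis`) and carry the covariance's natural
factor `(L^kε)²`; §1 is the bridge: `⟨δ_{y,j}, Xδ_{y′,j′}⟩ = (Xδ_{y′,j′})(y)_j`, `δ_{y′,j′} = (L^kε)^{−d}·(point mass e_{j′} at y′)`, and a kernel block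
with entries `≦ m` has operator norm `≦ N·m` (the typer g7's `B2Eq230CondShiftBound`), so `|⟨δ_{y,j}, Xδ_{y′,j′}⟩| ≦ N(L^kε)^{−d}m` and `(L^kε)^{−d}(L^kε)² = (L^kε)^{−(d−2)}` is exactly r14's
level currency.  The vector factor is the member `N = d`, `C = zeroCharge`, `m² = μ₀²`, `Ω = T_ε`, `Λ = T^{(k)}` of the scalar dictionary
(`fluctCov_eq_condCov232`; p. 608).

WHAT THIS FILE PROVES (kernel-checked, zero `sorry`, standard axioms; theorems only).
* §1 DICTIONARY: `siteDelta_eq_single`, **`toSite_bondDelta`** (`toSite (bondDelta b) = siteDelta b₋ μ(b)`), **`abs_siteInner_siteDelta_le_of_mat`**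
  (`|⟨δ_{y,j}, Xδ_{y′,j′}⟩| ≦ N·(L^kε)^{−d}·m` from an entrywise bound `m` on the `(y,·),(y′,·)` block of `mat X`), `abs_siteInner_bondDelta_le_of_mat`
  (`N = d`), **`fluctCov_eq_condCov232`**, `mesh_pow_inv_mul_sq`, `weaken_decay`.
* §2 (2.34) IN THE PAIRING CURRENCY AT ZERO BACKGROUND ON THE WHOLE TORUS, constants uniform in `L^kε ≦ 1`: **`pairing234_levelZero_zeroField`**
  (`k = 0`; `(c₁, δ₁) = (cSt, dSt)(N·K_d; min{a,8}/L², aL^{−2}e^{δ(L−1)} + (4d+m²)e^{δ}, δ)`, every `δ > 0`), **`pairing234_succ_zeroField`** (`1 ≦ k < K`,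
  r14 g9's uniform constants at the trivial regions `Λ_k = T^{(k)}`, `B^k(Λ_k) = T_ε`; admissible rate `(4d+4a)δ ≦ min{8, a(1−L^{−2})}`),
  **`pairing234_zeroField`** (all `0 ≦ k < K` with ONE pair `(max c, min δ)`), **`pairing234A_zeroField`** (the vector factor, `N = d`, `m² = μ₀²`).
* §3 **`abs_cumulantOf_rv357_le_zeroField`**: for `μ₀², m² > 0`, `a > 0`, `L > 1`, `0 ≦ k < K`, `L^kε ≦ 1`, an admissible `δ`, `n ≧ 1`, and (3.58) in the
  diameter currency (`|v^{(k)}(q;z;κ)| ≦ A₀e^{−δ₀diam z}`, the ONLY displayed input):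
  `|cumulantOf (nmoment (rv357 k qmax coef) (law356 C T_ε 0 μ₀² m² a k)) n| ≦ connConst d (N+d) n qmax (max (d·c_A) (N·c_φ)) δ₀ (min δ_A δ_φ)·A₀ⁿ·|T^{(k)}|`
  with `c_A, c_φ, δ_A, δ_φ` the §2 constants — independent of `k`, `ε`, the volume; **`_scale`** (`A₀ = C_v(L^kε)^{κ₀}` ⇒ `… C_vⁿ(L^kε)^{nκ₀}|T^{(k)}|`,
  print's `κ = nκ₀`); **`_printed`** (`∃ c ≧ 0, δ₁ > 0` depending on `(d, N, L, a, μ₀², m²)` only, valid on every torus with these `d, L`, every `C`,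
  `k < K`, `L^kε ≦ 1`, with the rate fixed at `δ = min{8,a(1−L^{−2})}/(4d+4a)`).
* §4 LEVEL `0`, `r`-REGULAR BACKGROUND `B^{(1)}` ON `T_ε` (the first step, measure `dμ_{C^{(0)}}(A′)dμ_{C^{(0)}(B^{(1)})}(φ′)` of (3.23), p. 616):
  **`ineq234_regular_torus_levelZero_uniform`** = (2.34) AT LEVEL `0` FOR `C^{(0)}_Λ(T_ε, B)` WITH CONSTANTS UNIFORM IN `ε ≦ 1` (new member of row
  B1.Prop2.3's instance list: `|B(⟨z+e_ν,μ′⟩) − B(⟨z,μ′⟩)| ≦ r`, `L²d(2dLε|e|r)² ≦ 1` ⇒ `|C^{(0),ε}_Λ(T_ε,B;p,q)| ≦ ε²c₁e^{−δ₁|x_p−x_q|}`,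
  `(c₁, δ₁) = (cSt, dSt)(N·K_d; 3min{a,4}/(4L²), aL^{−2}e^{δ(L−1)} + (4d+m²)e^{δ}, δ)` — r14's regular level-`0` (2.33)ₗ + the level-`0` (5.4) + the
  Sect.-5 engine + `decay_transfer`), `pairing234_levelZero_regular`, **`abs_cumulantOf_rv357_le_levelZero_regular`**
  (`|⟨(V^{(0)})ⁿ⟩^T| ≦ connConst(…, max(d·c_A, N·c_B), δ₀, min(δ_A, δ_B))·A₀ⁿ·|T_ε|` for `law356 C T_ε B μ₀² m² a 0`, no propagator hypothesis).
* §5 LEVELS `1 ≦ k < K` WITH THE BACKGROUND `A^{(k),ε}` OF (3.29) (`B1Eq31Concrete.bgVec μ₀² a k A`, `A` a block field on `T^{(k)}` with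
  `|A(x)| ≦ r`, `r·L^kε ≦ c_A(K₀)`) ON THE CUBE SUB-FAMILY (`M·L′_μ = L^m`, `K₀ ∣ M`, `3·L^kK₀ ≦ |T_ε|_μ`):
  **`abs_cumulantOf_rv357_le_bgVec_torus`** (printed/existential shape, mirroring r14 g13's `ineq234_236_bgVec_torus`: `∃ K₀min, c_A, c, δ₁` with
  `|⟨(V^{(k)})ⁿ⟩^T| ≦ connConst(d, N+d, n, q_max, c(K₀), δ₀, δ₁(K₀))·A₀ⁿ·|T^{(k)}|` for `law356 C T_ε A^{(k),ε} μ₀² m² a k` under (3.58) only — `h234φ` from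
  r14 g13's (2.34) at the (3.29) background, `h234A` from `pairing234A_zeroField` at the rate `min{8,a(1−L^{−2})}/(4d+4a)`).
* §6 LEVELS `1 ≦ k < K` AT A GENERAL `δ`-REGULAR BACKGROUND `B` ON `T_ε` (`|B(⟨z+e_ν,μ⟩) − B(⟨z,μ⟩)| ≦ δ`, `L^kδ·|e| ≦ t_A(K₀)`) ON THE CUBE
  SUB-FAMILY — Prop. 2.3's printed class with `Ω = T_ε`: **`abs_cumulantOf_rv357_le_regular_torus`** (same existential shape, for
  `law356 C T_ε B μ₀² m² a k`; `h234φ` from r14's `B1Props21to23RegularTorus.ineq234_236_regular_torus`).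
HONEST SCOPE.  (i) Zero head weight: rows B1.Eq3.23/3.24/3.59 unchanged; (3.57)/(3.58) stay DISPLAYED hypotheses (the diameter-currency `h358` of
the typer/r14; (3.58) as printed ⇒ `h358` is `B1Eq356DisplayedBounds.coef_bound_diam_of_steiner`); NO claim on the χ-weighted (3.24)/(3.59) (leaf (c),
[2] p. 152, NOT HELD).  (ii) Classes = those where the tree HAS (2.34) for BOTH covariances of (3.56) on the whole torus with scale-uniform constants:
zero background at all `k < K` (r14 g9), the regular background at `k = 0` (§4, new), and at `1 ≦ k < K` on the cube sub-family (`M·L′_μ = L^m`,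
`K₀ ∣ M`, `3·L^kK₀ ≦ |T_ε|_μ`; `K₀`-dependent constants, existential shape as printed there) the (3.29) background (§5, r14 g13) and a general
regular background (§6, r14); region classes `Ω = B^k(Λ_k)` do not live on the (3.56) carrier (conditioning set `T^{(k)}`), as in `B1Eq324DisplayedInteractionLeafModels`
HONEST SCOPE (iii).  (iii) Constants crude (the Sect.-5 engine's `cSt`/`dSt`), per level class (`k = 0` vs `k ≧ 1`) and merged by `max`/`min`; the
factor `N` (resp. `d`) is the price of the arbitrary orthonormal frame of the coordinates (`norm_kernel_le_of_abs_mat_le`), immaterial.  (iv) The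
rate parameter `δ` and its admissibility condition are r14 g9's ((2.27)-type input of the zero-field (5.4)); the printed *"δ₀, c₀ dependent on d and
a"* is delivered as explicit functions of `(d, N, L, a, μ₀², m², δ)`.  (v) `k < K` strictly, `L^kε ≦ 1` (the (2.34) files' range).  (vi) Value =
kernel certificate that the print's one-line argument *"connected graphs with exponentially decaying propagators ⇒ O(ε^κ)|T₁|"* closes on the concrete
objects of the (Higgs)₂,₃ construction with NO analytic input left open except (3.58); NOT summit progress; NOT Clay.
-/

open scoped BigOperators
open _root_.MeasureTheory

namespace Literature.MathematicalPhysics.QuantumFieldTheory.Balaban1983to89.B1Eq323DisplayedCumulantBoundModels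

open HiggsLattice (ChargeData siteInner)
open HiggsCovariance (E kernel)
open B3MultiscaleFields (toSite zeroCharge)
open HiggsFluctMeasure (fluctCov)
open HiggsCondCov232 (condCov232 condCov232_univ)
open B1Eq230FluctCov (mat Ix cb precOpA fluctCovA fluctCovA_zero_field)
open B1Eq324SmallFieldLeaf (bondDelta siteDelta siteInner_siteDelta)
open B2Eq230CondShiftBound (norm_kernel_le_of_abs_mat_le)
open B2Eq230CondShift (kernel_apply_single)

noncomputable section

variable {P : HiggsLattice.Params} {N : ℕ} {k : ℕ}

/-! ## §1 Dictionary: the pairing (1.5) at point sources versus the coordinate kernel entries `mat` -/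

/-- The test field `siteDelta y i` of r14's leaf files is the point mass `δ_y·(L^kε)^{−d}e_i`. [cite: Balaban1982Higgs1, (1.5) p.604] -/
theorem siteDelta_eq_single (y : HiggsLattice.Site P k) (i : Fin N) :
    siteDelta (P := P) y i = Pi.single y ((P.mesh k ^ P.d)⁻¹ • EuclideanSpace.single i (1 : ℝ)) := by
  funext z
  by_cases hz : z = y
  · subst hz
    simp [siteDelta]
  · simp [siteDelta, hz]

/-- The bond test field of the vector factor IS the site test field of the `N = d` dictionary (p. 608: *"taking N = d and an external
vector field A = 0"*): `toSite (bondDelta b) = siteDelta b₋ μ(b)`. [cite: Balaban1982Higgs1, (1.5) p.604; p.608] -/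
theorem toSite_bondDelta (b : HiggsLattice.PBond P k) :
    toSite (bondDelta b) = siteDelta (N := P.d) b.src b.dir := by
  funext x
  ext μ
  by_cases hx : x = b.src
  · subst hx
    by_cases hμ : μ = b.dir
    · subst hμ
      have hb : (⟨b.src, b.dir⟩ : HiggsLattice.PBond P k) = b := rfl
      simp [toSite, bondDelta, siteDelta, hb]
    · have hb : (⟨b.src, μ⟩ : HiggsLattice.PBond P k) ≠ b := by
        intro h; exact hμ (by rw [← h])
      simp [toSite, bondDelta, siteDelta, hb, hμ]
  · have hb : (⟨x, μ⟩ : HiggsLattice.PBond P k) ≠ b := by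
      intro h; exact hx (by rw [← h])
    simp [toSite, bondDelta, siteDelta, hb, hx]

/-- **POINT-SOURCE PAIRINGS ARE CONTROLLED BY THE KERNEL ENTRIES**: if the `(y,·),(y′,·)` block of the coordinate matrix of an operator `X`
on the fields of `T^{(k)}` (p35's `mat`, entries in the orthonormal site frame of p. 605) is bounded entrywise by `m ≥ 0`, then
`|⟨δ_{y,j}, Xδ_{y′,j′}⟩| ≤ N·(L^kε)^{−d}·m` for all standard components `j, j′` (the kernel block has operator norm `≤ N·m`,
`B2Eq230CondShiftBound.norm_kernel_le_of_abs_mat_le`; `‖(L^kε)^{−d}e_{j′}‖ = (L^kε)^{−d}`; the factor `N` is the price of the arbitrary frame).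
[cite: Balaban1982Higgs1, (1.5) p.604; (2.24) p.610] -/
theorem abs_siteInner_siteDelta_le_of_mat (X : Module.End ℝ (HiggsLattice.ScalarField P k N)) (y y' : HiggsLattice.Site P k)
    {m : ℝ} (hm0 : 0 ≤ m) (hm : ∀ i i' : Ix N, |mat X (y, i) (y', i')| ≤ m) (j j' : Fin N) :
    |siteInner (siteDelta y j) (X (siteDelta y' j'))| ≤ (N : ℝ) * (P.mesh k ^ P.d)⁻¹ * m := by
  have hη : 0 < (P.mesh k ^ P.d)⁻¹ := inv_pos.mpr (pow_pos (P.mesh_pos k) _)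
  set v : E N := (P.mesh k ^ P.d)⁻¹ • EuclideanSpace.single j' (1 : ℝ) with hv
  have hvn : ‖v‖ = (P.mesh k ^ P.d)⁻¹ := by
    rw [hv, norm_smul, Real.norm_of_nonneg hη.le]
    simp
  rw [siteInner_siteDelta, siteDelta_eq_single, ← hv, ← kernel_apply_single]
  have h1 : |(kernel X y y' v) j| ≤ ‖kernel X y y' v‖ := by
    rw [← Real.norm_eq_abs]
    exact PiLp.norm_apply_le _ j
  have h2 := norm_kernel_le_of_abs_mat_le X y y' hm0 hm v
  rw [hvn] at h2
  calc _ ≤ _ := h1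
    _ ≤ _ := h2
    _ = _ := by ring

/-- The bond version (`N = d`): `|⟨δ_b, Xδ_{b′}⟩| ≤ d·(L^kε)^{−d}·m` from an entrywise bound `m` on the `(b₋,·),(b′₋,·)` block.
[cite: Balaban1982Higgs1, (1.5) p.604; (2.24) p.610] -/
theorem abs_siteInner_bondDelta_le_of_mat (X : Module.End ℝ (HiggsLattice.ScalarField P k P.d)) (b b' : HiggsLattice.PBond P k)
    {m : ℝ} (hm0 : 0 ≤ m) (hm : ∀ i i' : Ix P.d, |mat X (b.src, i) (b'.src, i')| ≤ m) :
    |siteInner (toSite (bondDelta b)) (X (toSite (bondDelta b')))| ≤ (P.d : ℝ) * (P.mesh k ^ P.d)⁻¹ * m := by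
  rw [toSite_bondDelta, toSite_bondDelta]
  exact abs_siteInner_siteDelta_le_of_mat X b.src b'.src hm0 hm b.dir b'.dir

/-- The vector fluctuation covariance `C^{(k)}` of (2.30) IS the conditional covariance (2.32) of the scalar dictionary at `N = d`, zero
field, `Ω = T_ε`, `Λ = T^{(k)}` (`B1Eq230FluctCov.fluctCovA_zero_field`, `HiggsCondCov232.condCov232_univ`). [cite: Balaban1982Higgs1, (2.30) p.611; (2.32) p.611] -/
theorem fluctCov_eq_condCov232 (μ0sq a : ℝ) (k : ℕ) :
    fluctCov P μ0sq a k
      = condCov232 (zeroCharge P.d) Finset.univ (0 : HiggsLattice.VecField P 0) μ0sq a k (Finset.univ : Finset (HiggsLattice.Site P k)) := by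
  rw [condCov232_univ, fluctCovA_zero_field]


/-! ## §2 Prop. 2.3 (2.34) IN THE PAIRING CURRENCY OF THE (3.23) CHAIN, ZERO BACKGROUND, `Ω = T_ε`, constants uniform in `L^kε ≤ 1` -/

section ZeroField

open B4Sect5Torus (cSt dSt cSt_pos dSt_pos)
open B1Ineq234Concrete (profile profile_nonneg')
open B2Prop31ZeroFieldConcrete (gamma0)
open B2Eq337ScalarIntegration (Regions)
open B2Eq328ConcretePieces (pieceF)
open B1Ineq233LowerZeroFieldTorus (lowConst_pos)
open B1Ineq18ZeroFieldRegion (gammaZero_pos)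
open B1Ineq234ZeroFieldRegionUniform (ineq234_zeroField_region_levelZero_uniform ineq234_zeroField_region_uniform)

variable (C : ChargeData N) {a msq μ0sq : ℝ}

/-- `(L^kε)^{−d}·(L^kε)² = (L^kε)^{−(d−2)}`: the covariance's natural factor `(L^kε)²` on the `L^kε`-lattice against the `(L^kε)^{−d}` of the
point source gives the level currency of r14's `h234A`/`h234φ`. [cite: Balaban1982Higgs1, (2.31) p.611] -/
theorem mesh_pow_inv_mul_sq (k : ℕ) : (P.mesh k ^ P.d)⁻¹ * P.mesh k ^ 2 = P.mesh k ^ (-((P.d : ℝ) - 2)) := by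
  have hm : 0 < P.mesh k := P.mesh_pos k
  rw [show (-((P.d : ℝ) - 2)) = (2 : ℝ) - (P.d : ℝ) by ring, Real.rpow_sub hm, Real.rpow_natCast,
    show (2 : ℝ) = ((2 : ℕ) : ℝ) by norm_num, Real.rpow_natCast, div_eq_mul_inv, mul_comm]

/-- **(2.34) AT LEVEL `0`, ZERO BACKGROUND, `Ω = T_ε`, IN THE PAIRING (1.5) AT POINT SOURCES** (the shape of r14's `h234φ`): for `m² > 0`, `a > 0`,
`L > 1`, `0 < K`, `ε ≤ 1`, every rate parameter `δ > 0`, all sites and components,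
`|⟨δ_{y,j}, C^{(0)}_{T_ε}(T_ε, 0)δ_{y′,j′}⟩| ≤ N·c₁·ε^{−(d−2)}·e^{−δ₁|y−y′|}`, `(c₁, δ₁) = (cSt, dSt)(N·K_d; min{a,8}/L², aL^{−2}e^{δ(L−1)} + (4d+m²)e^{δ}, δ)`
— r14 g9's `ineq234_zeroField_region_levelZero_uniform` (entrywise, factor `ε²`) through §1. [cite: Balaban1982Higgs1, Prop. 2.3 (2.34) p.611] -/
theorem pairing234_levelZero_zeroField (ha : 0 < a) (hL : 1 < P.L) (hmsq : 0 < msq) (hK : 0 < P.K) (hs : P.mesh 0 ≤ 1)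
    {δ : ℝ} (hδ : 0 < δ) (y y' : HiggsLattice.Site P 0) (j j' : Fin N) :
    |siteInner (siteDelta y j)
        (condCov232 C Finset.univ (0 : HiggsLattice.VecField P 0) msq a 0 (Finset.univ : Finset (HiggsLattice.Site P 0)) (siteDelta y' j'))|
      ≤ (N : ℝ) * cSt (profile P N) (min a 8 / (P.L : ℝ) ^ 2)
            (a * ((P.L : ℝ) ^ 2)⁻¹ * Real.exp (δ * ((P.L : ℝ) - 1)) + (4 * P.d + msq) * Real.exp δ) δ
          * P.mesh 0 ^ (-((P.d : ℝ) - 2))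
          * Real.exp (-(dSt (profile P N) (min a 8 / (P.L : ℝ) ^ 2)
              (a * ((P.L : ℝ) ^ 2)⁻¹ * Real.exp (δ * ((P.L : ℝ) - 1)) + (4 * P.d + msq) * Real.exp δ) δ
              * (HiggsLattice.Site.tdist y y' : ℝ))) := by
  set c := cSt (profile P N) (min a 8 / (P.L : ℝ) ^ 2)
    (a * ((P.L : ℝ) ^ 2)⁻¹ * Real.exp (δ * ((P.L : ℝ) - 1)) + (4 * P.d + msq) * Real.exp δ) δ with hc
  set r := dSt (profile P N) (min a 8 / (P.L : ℝ) ^ 2)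
    (a * ((P.L : ℝ) ^ 2)⁻¹ * Real.exp (δ * ((P.L : ℝ) - 1)) + (4 * P.d + msq) * Real.exp δ) δ with hr
  have hL0 : (0 : ℝ) < (P.L : ℝ) := by exact_mod_cast (lt_trans Nat.zero_lt_one hL)
  have hγ : 0 < min a 8 / (P.L : ℝ) ^ 2 := div_pos (lt_min ha (by norm_num)) (pow_pos hL0 2)
  have hc0 : 0 < c := cSt_pos _ _ _ hγ
  have hm : 0 < P.mesh 0 := P.mesh_pos 0
  have hmat : ∀ i i' : Ix N,
      |mat (condCov232 C Finset.univ (0 : HiggsLattice.VecField P 0) msq a 0 (Finset.univ : Finset (HiggsLattice.Site P 0)))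
          (y, i) (y', i')| ≤ P.mesh 0 ^ 2 * c * Real.exp (-(r * (HiggsLattice.Site.tdist y y' : ℝ))) :=
    fun i i' => ineq234_zeroField_region_levelZero_uniform C Finset.univ ha hL hmsq hK hs hδ (fun _ _ _ => by simp)
      (Λ := Finset.univ) subset_rfl (p := (y, i)) (q := (y', i')) (Finset.mem_univ _) (Finset.mem_univ _)
  have h := abs_siteInner_siteDelta_le_of_mat _ y y' (by positivity) hmat j j'
  calc _ ≤ _ := h
    _ = (N : ℝ) * c * ((P.mesh 0 ^ P.d)⁻¹ * P.mesh 0 ^ 2) * Real.exp (-(r * (HiggsLattice.Site.tdist y y' : ℝ))) := by ring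
    _ = _ := by rw [mesh_pow_inv_mul_sq]

/-- **(2.34) AT THE LEVELS `1 ≤ k < K`, ZERO BACKGROUND, WHOLE TORUS, IN THE PAIRING AT POINT SOURCES**: for `m² > 0`, `a > 0`, `L > 1`,
`k = j+1 < K`, `L^kε ≤ 1` and an admissible rate `δ > 0`, `(4d + 4a)δ ≤ min{8, a(1 − L^{−2})}`:
`|⟨δ_{y,i}, C^{(k)}_{T^{(k)}}(T_ε, 0)δ_{y′,i′}⟩| ≤ N·c₁·(L^kε)^{−(d−2)}·e^{−δ₁|y−y′|}` with r14 g9's uniform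
`(c₁, δ₁) = (cSt, dSt)(N·K_d; min{a,8γ₀}/L², aL^{−2}e^{δ(L−1)} + a + a²(2/min{8,a(1−L^{−2})})e^{δ}, δ)` — `ineq234_zeroField_region_uniform` at the
trivial regions `Λ_k = T^{(k)}` (so `B^k(Λ_k) = T_ε`), through §1. [cite: Balaban1982Higgs1, Prop. 2.3 (2.34) p.611] -/
theorem pairing234_succ_zeroField (ha : 0 < a) (hL : 1 < P.L) (hmsq : 0 < msq) {j : ℕ} (hjK : j + 1 < P.K)
    (hs : P.mesh (j + 1) ≤ 1) {δ : ℝ} (hδ0 : 0 < δ) (hδ : (4 * P.d + 4 * a) * δ ≤ min 8 (a * (1 - ((P.L : ℝ) ^ 2)⁻¹)))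
    (y y' : HiggsLattice.Site P (j + 1)) (i i' : Fin N) :
    |siteInner (siteDelta y i)
        (condCov232 C Finset.univ (0 : HiggsLattice.VecField P 0) msq a (j + 1) (Finset.univ : Finset (HiggsLattice.Site P (j + 1)))
          (siteDelta y' i'))|
      ≤ (N : ℝ) * cSt (profile P N) (min a (8 * gamma0 P a msq) / (P.L : ℝ) ^ 2)
            (a * ((P.L : ℝ) ^ 2)⁻¹ * Real.exp (δ * ((P.L : ℝ) - 1)) + a +
              a ^ 2 * (2 / min 8 (a * (1 - ((P.L : ℝ) ^ 2)⁻¹)) * Real.exp δ)) δ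
          * P.mesh (j + 1) ^ (-((P.d : ℝ) - 2))
          * Real.exp (-(dSt (profile P N) (min a (8 * gamma0 P a msq) / (P.L : ℝ) ^ 2)
              (a * ((P.L : ℝ) ^ 2)⁻¹ * Real.exp (δ * ((P.L : ℝ) - 1)) + a +
                a ^ 2 * (2 / min 8 (a * (1 - ((P.L : ℝ) ^ 2)⁻¹)) * Real.exp δ)) δ
              * (HiggsLattice.Site.tdist y y' : ℝ))) := by
  set c := cSt (profile P N) (min a (8 * gamma0 P a msq) / (P.L : ℝ) ^ 2)
    (a * ((P.L : ℝ) ^ 2)⁻¹ * Real.exp (δ * ((P.L : ℝ) - 1)) + a +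
      a ^ 2 * (2 / min 8 (a * (1 - ((P.L : ℝ) ^ 2)⁻¹)) * Real.exp δ)) δ with hc
  set r := dSt (profile P N) (min a (8 * gamma0 P a msq) / (P.L : ℝ) ^ 2)
    (a * ((P.L : ℝ) ^ 2)⁻¹ * Real.exp (δ * ((P.L : ℝ) - 1)) + a +
      a ^ 2 * (2 / min 8 (a * (1 - ((P.L : ℝ) ^ 2)⁻¹)) * Real.exp δ)) δ with hr
  have hc0 : 0 < c := cSt_pos _ _ _ (lowConst_pos ha hL hmsq.le)
  have hm : 0 < P.mesh (j + 1) := P.mesh_pos _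
  -- the trivial regions `Λ₅⁽⁰⁾ = T_ε`, `Λ_k = T^{(k)}` for every `k`
  set R : Regions P P.K := ⟨Finset.univ, fun _ => Finset.univ⟩ with hR
  have hpiece : pieceF R ⟨j, by omega⟩ = (Finset.univ : Finset (HiggsLattice.Site P 0)) :=
    Finset.eq_univ_iff_forall.mpr fun x => by simp [hR, B2Eq328ConcretePieces.mem_pieceF, B2Eq328ConcretePieces.inPiece]
  have hmat : ∀ ι ι' : Ix N,
      |mat (condCov232 C Finset.univ (0 : HiggsLattice.VecField P 0) msq a (j + 1)
          (Finset.univ : Finset (HiggsLattice.Site P (j + 1)))) (y, ι) (y', ι')|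
        ≤ P.mesh (j + 1) ^ 2 * c * Real.exp (-(r * (HiggsLattice.Site.tdist y y' : ℝ))) := by
    intro ι ι'
    have h := ineq234_zeroField_region_uniform R C ha hL hmsq le_rfl ⟨j, by omega⟩ hjK hs (fun _ _ _ => by simp [hR]) hδ0 hδ
      (Λ := Finset.univ) (fun _ _ => by simp [hR]) (p := (y, ι)) (q := (y', ι')) (Finset.mem_univ _) (Finset.mem_univ _)
    rw [hpiece] at h
    exact h
  have h := abs_siteInner_siteDelta_le_of_mat _ y y' (by positivity) hmat i i'
  calc _ ≤ _ := h
    _ = (N : ℝ) * c * ((P.mesh (j + 1) ^ P.d)⁻¹ * P.mesh (j + 1) ^ 2) * Real.exp (-(r * (HiggsLattice.Site.tdist y y' : ℝ))) := by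
        ring
    _ = _ := by rw [mesh_pow_inv_mul_sq]

/-- Weakening of a bound of the shape `N·c·s·e^{−rt}` in the constant and the rate. [folklore] [cite: Balaban1982Higgs1, (2.34) p.611] -/
theorem weaken_decay {n s c c' r r' t : ℝ} (hn : 0 ≤ n) (hs : 0 ≤ s) (hc : c ≤ c') (hc' : 0 ≤ c') (hr : r' ≤ r) (ht : 0 ≤ t) :
    n * c * s * Real.exp (-(r * t)) ≤ n * c' * s * Real.exp (-(r' * t)) := by
  have h : c * Real.exp (-(r * t)) ≤ c' * Real.exp (-(r' * t)) :=
    (mul_le_mul_of_nonneg_right hc (Real.exp_pos _).le).trans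
      (mul_le_mul_of_nonneg_left (Real.exp_le_exp.mpr (by nlinarith)) hc')
  calc n * c * s * Real.exp (-(r * t)) = (n * s) * (c * Real.exp (-(r * t))) := by ring
    _ ≤ (n * s) * (c' * Real.exp (-(r' * t))) := mul_le_mul_of_nonneg_left h (mul_nonneg hn hs)
    _ = _ := by ring

/-- **(2.34) AT ZERO BACKGROUND ON THE WHOLE TORUS FOR ALL LEVELS `0 ≤ k < K` AT ONCE** (pairing at point sources), with ONE pair of constants:
`c₁ = max(c₁⁽⁰⁾, c₁⁽≥¹⁾)`, `δ₁ = min(δ₁⁽⁰⁾, δ₁⁽≥¹⁾)` of `pairing234_levelZero_zeroField` / `pairing234_succ_zeroField` — functions of `(d, N, L, a, m², δ)`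
only, not of `k`, `ε ≤ 1` or the volume. [cite: Balaban1982Higgs1, Prop. 2.3 (2.34) p.611] -/
theorem pairing234_zeroField (ha : 0 < a) (hL : 1 < P.L) (hmsq : 0 < msq) {k : ℕ} (hk : k < P.K) (hs : P.mesh k ≤ 1)
    {δ : ℝ} (hδ0 : 0 < δ) (hδ : (4 * P.d + 4 * a) * δ ≤ min 8 (a * (1 - ((P.L : ℝ) ^ 2)⁻¹)))
    (y y' : HiggsLattice.Site P k) (i i' : Fin N) :
    |siteInner (siteDelta y i)
        (condCov232 C Finset.univ (0 : HiggsLattice.VecField P 0) msq a k (Finset.univ : Finset (HiggsLattice.Site P k)) (siteDelta y' i'))|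
      ≤ (N : ℝ)
          * max (cSt (profile P N) (min a 8 / (P.L : ℝ) ^ 2)
                  (a * ((P.L : ℝ) ^ 2)⁻¹ * Real.exp (δ * ((P.L : ℝ) - 1)) + (4 * P.d + msq) * Real.exp δ) δ)
                (cSt (profile P N) (min a (8 * gamma0 P a msq) / (P.L : ℝ) ^ 2)
                  (a * ((P.L : ℝ) ^ 2)⁻¹ * Real.exp (δ * ((P.L : ℝ) - 1)) + a +
                    a ^ 2 * (2 / min 8 (a * (1 - ((P.L : ℝ) ^ 2)⁻¹)) * Real.exp δ)) δ)
          * P.mesh k ^ (-((P.d : ℝ) - 2))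
          * Real.exp (-(min (dSt (profile P N) (min a 8 / (P.L : ℝ) ^ 2)
                  (a * ((P.L : ℝ) ^ 2)⁻¹ * Real.exp (δ * ((P.L : ℝ) - 1)) + (4 * P.d + msq) * Real.exp δ) δ)
                (dSt (profile P N) (min a (8 * gamma0 P a msq) / (P.L : ℝ) ^ 2)
                  (a * ((P.L : ℝ) ^ 2)⁻¹ * Real.exp (δ * ((P.L : ℝ) - 1)) + a +
                    a ^ 2 * (2 / min 8 (a * (1 - ((P.L : ℝ) ^ 2)⁻¹)) * Real.exp δ)) δ)
              * (HiggsLattice.Site.tdist y y' : ℝ))) := by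
  have hL0 : (0 : ℝ) < (P.L : ℝ) := by exact_mod_cast (lt_trans Nat.zero_lt_one hL)
  have hγ0 : 0 < min a 8 / (P.L : ℝ) ^ 2 := div_pos (lt_min ha (by norm_num)) (pow_pos hL0 2)
  have hc1 : 0 ≤ cSt (profile P N) (min a (8 * gamma0 P a msq) / (P.L : ℝ) ^ 2)
      (a * ((P.L : ℝ) ^ 2)⁻¹ * Real.exp (δ * ((P.L : ℝ) - 1)) + a +
        a ^ 2 * (2 / min 8 (a * (1 - ((P.L : ℝ) ^ 2)⁻¹)) * Real.exp δ)) δ := (cSt_pos _ _ _ (lowConst_pos ha hL hmsq.le)).le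
  have hN : (0 : ℝ) ≤ N := Nat.cast_nonneg N
  have hsk : 0 ≤ P.mesh k ^ (-((P.d : ℝ) - 2)) := Real.rpow_nonneg (P.mesh_pos k).le _
  have ht : 0 ≤ (HiggsLattice.Site.tdist y y' : ℝ) := Nat.cast_nonneg _
  cases k with
  | zero =>
      exact (pairing234_levelZero_zeroField C ha hL hmsq hk hs hδ0 y y' i i').trans
        (weaken_decay hN hsk (le_max_left _ _) (hc1.trans (le_max_right _ _)) (min_le_left _ _) ht)
  | succ j =>
      exact (pairing234_succ_zeroField C ha hL hmsq hk hs hδ0 hδ y y' i i').trans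
        (weaken_decay hN hsk (le_max_right _ _) (hc1.trans (le_max_right _ _)) (min_le_right _ _) ht)

/-- **THE VECTOR FACTOR**: (2.34) for the fluctuation covariance `C^{(k)}` of `dμ_{C^{(k)}}(A′)` (2.30) in the pairing at bond sources — the shape of
r14's `h234A` — for all `0 ≤ k < K`, `L^kε ≤ 1`: the member `N = d`, `m² = μ₀²` of `pairing234_zeroField` (`fluctCov_eq_condCov232`,
`toSite_bondDelta`). [cite: Balaban1982Higgs1, Prop. 2.3 (2.34) p.611; (2.30) p.611] -/
theorem pairing234A_zeroField (ha : 0 < a) (hL : 1 < P.L) (hμ : 0 < μ0sq) {k : ℕ} (hk : k < P.K) (hs : P.mesh k ≤ 1)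
    {δ : ℝ} (hδ0 : 0 < δ) (hδ : (4 * P.d + 4 * a) * δ ≤ min 8 (a * (1 - ((P.L : ℝ) ^ 2)⁻¹)))
    (b b' : HiggsLattice.PBond P k) :
    |siteInner (toSite (bondDelta b)) (fluctCov P μ0sq a k (toSite (bondDelta b')))|
      ≤ (P.d : ℝ)
          * max (cSt (profile P P.d) (min a 8 / (P.L : ℝ) ^ 2)
                  (a * ((P.L : ℝ) ^ 2)⁻¹ * Real.exp (δ * ((P.L : ℝ) - 1)) + (4 * P.d + μ0sq) * Real.exp δ) δ)
                (cSt (profile P P.d) (min a (8 * gamma0 P a μ0sq) / (P.L : ℝ) ^ 2)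
                  (a * ((P.L : ℝ) ^ 2)⁻¹ * Real.exp (δ * ((P.L : ℝ) - 1)) + a +
                    a ^ 2 * (2 / min 8 (a * (1 - ((P.L : ℝ) ^ 2)⁻¹)) * Real.exp δ)) δ)
          * P.mesh k ^ (-((P.d : ℝ) - 2))
          * Real.exp (-(min (dSt (profile P P.d) (min a 8 / (P.L : ℝ) ^ 2)
                  (a * ((P.L : ℝ) ^ 2)⁻¹ * Real.exp (δ * ((P.L : ℝ) - 1)) + (4 * P.d + μ0sq) * Real.exp δ) δ)
                (dSt (profile P P.d) (min a (8 * gamma0 P a μ0sq) / (P.L : ℝ) ^ 2)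
                  (a * ((P.L : ℝ) ^ 2)⁻¹ * Real.exp (δ * ((P.L : ℝ) - 1)) + a +
                    a ^ 2 * (2 / min 8 (a * (1 - ((P.L : ℝ) ^ 2)⁻¹)) * Real.exp δ)) δ)
              * (HiggsLattice.Site.tdist b.src b'.src : ℝ))) := by
  rw [fluctCov_eq_condCov232, toSite_bondDelta, toSite_bondDelta]
  exact pairing234_zeroField (zeroCharge P.d) ha hL hμ hk hs hδ0 hδ b.src b'.src b.dir b'.dir

end ZeroField

/-! ## §3 (3.23) *"Hence ⟨Vⁿ⟩^T = O(ε^κ)|T₁|"* for the displayed `V^{(k)}` at zero background on the whole torus, NO propagator hypothesis -/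

section Cumulant

open B4Sect5Torus (cSt dSt cSt_pos dSt_pos)
open B1Ineq234Concrete (profile profile_nonneg')
open B2Prop31ZeroFieldConcrete (gamma0)
open B1Ineq233LowerZeroFieldTorus (lowConst_pos)
open B1Ineq18ZeroFieldRegion (gammaZero_pos)
open B1Prop32InteractionBound (Leg)
open B1Ineq358TreeDecaySum (diam)
open Literature.Probability.LatticeModels (cumulantOf)
open B10Eq24Cumulant (nmoment)
open B1Eq323ConnectedGraphBound (connConst)
open B1Eq357FluctuationPolynomial (law356 rv357)
open B1Eq323DisplayedCumulantBound (abs_cumulantOf_rv357_le_of_ineq234)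

variable (C : ChargeData N) {a msq μ0sq : ℝ}

/-- **(3.23) FOR THE DISPLAYED `V^{(k)}` OF (3.57) ON THE LAW OF (3.56) AT ZERO BACKGROUND ON THE WHOLE TORUS, WITH NO PROPAGATOR HYPOTHESIS** — p. 616:
*"⟨Vⁿ⟩^T is the expression corresponding to the sum of connected graphs with exponentially decaying propagators. Hence ⟨Vⁿ⟩^T = O(ε^κ)|T₁|"*:
for `μ₀², m² > 0`, `a > 0`, `L > 1`, every level `0 ≤ k < K` with `L^kε ≤ 1`, an admissible rate parameter `δ`, `n ≥ 1`, and (3.58) in the diameter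
currency (`|v^{(k)}(q;z;κ)| ≤ A₀e^{−δ₀·diam z}`, the ONLY displayed input left):
`|⟨(V^{(k)})ⁿ⟩^T| ≤ connConst(d, N+d, n, q_max, c, δ₀, δ₁)·A₀ⁿ·|T^{(k)}|` with `c = max(d·c_A, N·c_φ)`, `δ₁ = min(δ_A, δ_φ)` the constants of
`pairing234A_zeroField` / `pairing234_zeroField` — r14's `abs_cumulantOf_rv357_le_of_ineq234` (p396542) with `h234A`, `h234φ` DISCHARGED from the cell's
Prop. 2.3 instances; every constant independent of `k`, `ε` and the volume. [cite: Balaban1982Higgs1, (3.23) p.616; Prop. 2.3 (2.34) p.611; Prop. 3.2 (3.56)–(3.58) p.622] -/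
theorem abs_cumulantOf_rv357_le_zeroField (hμ : 0 < μ0sq) (hmsq : 0 < msq) (ha : 0 < a) (hL : 1 < P.L)
    {k : ℕ} (hk : k < P.K) (hs : P.mesh k ≤ 1)
    {δ : ℝ} (hδ0 : 0 < δ) (hδ : (4 * P.d + 4 * a) * δ ≤ min 8 (a * (1 - ((P.L : ℝ) ^ 2)⁻¹)))
    (qmax : ℕ) (coef : (q : ℕ) → (Fin q → HiggsLattice.Site P k) → (Fin q → Leg N P.d) → ℝ) {n : ℕ} [NeZero n]
    {A₀ δ₀ : ℝ} (hA₀ : 0 ≤ A₀) (hδ₀ : 0 < δ₀)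
    (h358 : ∀ q, q ≤ qmax → ∀ (z : Fin q → HiggsLattice.Site P k) (κ : Fin q → Leg N P.d),
      |coef q z κ| ≤ A₀ * Real.exp (-(δ₀ * (diam z : ℝ)))) :
    |cumulantOf (nmoment (rv357 k qmax coef) (law356 C Finset.univ (0 : HiggsLattice.VecField P 0) μ0sq msq a k)) n|
      ≤ connConst P.d (N + P.d) n qmax
            (max ((P.d : ℝ)
                    * max (cSt (profile P P.d) (min a 8 / (P.L : ℝ) ^ 2)
                            (a * ((P.L : ℝ) ^ 2)⁻¹ * Real.exp (δ * ((P.L : ℝ) - 1)) + (4 * P.d + μ0sq) * Real.exp δ) δ)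
                          (cSt (profile P P.d) (min a (8 * gamma0 P a μ0sq) / (P.L : ℝ) ^ 2)
                            (a * ((P.L : ℝ) ^ 2)⁻¹ * Real.exp (δ * ((P.L : ℝ) - 1)) + a +
                              a ^ 2 * (2 / min 8 (a * (1 - ((P.L : ℝ) ^ 2)⁻¹)) * Real.exp δ)) δ))
                 ((N : ℝ)
                    * max (cSt (profile P N) (min a 8 / (P.L : ℝ) ^ 2)
                            (a * ((P.L : ℝ) ^ 2)⁻¹ * Real.exp (δ * ((P.L : ℝ) - 1)) + (4 * P.d + msq) * Real.exp δ) δ)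
                          (cSt (profile P N) (min a (8 * gamma0 P a msq) / (P.L : ℝ) ^ 2)
                            (a * ((P.L : ℝ) ^ 2)⁻¹ * Real.exp (δ * ((P.L : ℝ) - 1)) + a +
                              a ^ 2 * (2 / min 8 (a * (1 - ((P.L : ℝ) ^ 2)⁻¹)) * Real.exp δ)) δ)))
            δ₀
            (min (min (dSt (profile P P.d) (min a 8 / (P.L : ℝ) ^ 2)
                        (a * ((P.L : ℝ) ^ 2)⁻¹ * Real.exp (δ * ((P.L : ℝ) - 1)) + (4 * P.d + μ0sq) * Real.exp δ) δ)
                      (dSt (profile P P.d) (min a (8 * gamma0 P a μ0sq) / (P.L : ℝ) ^ 2)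
                        (a * ((P.L : ℝ) ^ 2)⁻¹ * Real.exp (δ * ((P.L : ℝ) - 1)) + a +
                          a ^ 2 * (2 / min 8 (a * (1 - ((P.L : ℝ) ^ 2)⁻¹)) * Real.exp δ)) δ))
                 (min (dSt (profile P N) (min a 8 / (P.L : ℝ) ^ 2)
                        (a * ((P.L : ℝ) ^ 2)⁻¹ * Real.exp (δ * ((P.L : ℝ) - 1)) + (4 * P.d + msq) * Real.exp δ) δ)
                      (dSt (profile P N) (min a (8 * gamma0 P a msq) / (P.L : ℝ) ^ 2)
                        (a * ((P.L : ℝ) ^ 2)⁻¹ * Real.exp (δ * ((P.L : ℝ) - 1)) + a +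
                          a ^ 2 * (2 / min 8 (a * (1 - ((P.L : ℝ) ^ 2)⁻¹)) * Real.exp δ)) δ)))
        * A₀ ^ n * Fintype.card (HiggsLattice.Site P k) := by
  have hLr : (1 : ℝ) < (P.L : ℝ) := by exact_mod_cast hL
  have hL0 : (0 : ℝ) < (P.L : ℝ) := by linarith
  -- the kernel constants of the two level classes are nonnegative, the form constants positive
  have hγ0 : 0 < min a 8 / (P.L : ℝ) ^ 2 := div_pos (lt_min ha (by norm_num)) (pow_pos hL0 2)
  have hγZ := gammaZero_pos (P := P) ha hL
  have hκ0 : ∀ m : ℝ, 0 < m → 0 ≤ a * ((P.L : ℝ) ^ 2)⁻¹ * Real.exp (δ * ((P.L : ℝ) - 1)) + (4 * P.d + m) * Real.exp δ := by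
    intro m hm; positivity
  have hκ1 : 0 ≤ a * ((P.L : ℝ) ^ 2)⁻¹ * Real.exp (δ * ((P.L : ℝ) - 1)) + a +
      a ^ 2 * (2 / min 8 (a * (1 - ((P.L : ℝ) ^ 2)⁻¹)) * Real.exp δ) := by positivity
  -- nonnegativity / positivity of the assembled constants
  set cA := (P.d : ℝ)
      * max (cSt (profile P P.d) (min a 8 / (P.L : ℝ) ^ 2)
              (a * ((P.L : ℝ) ^ 2)⁻¹ * Real.exp (δ * ((P.L : ℝ) - 1)) + (4 * P.d + μ0sq) * Real.exp δ) δ)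
            (cSt (profile P P.d) (min a (8 * gamma0 P a μ0sq) / (P.L : ℝ) ^ 2)
              (a * ((P.L : ℝ) ^ 2)⁻¹ * Real.exp (δ * ((P.L : ℝ) - 1)) + a +
                a ^ 2 * (2 / min 8 (a * (1 - ((P.L : ℝ) ^ 2)⁻¹)) * Real.exp δ)) δ) with hcA
  set cφ := (N : ℝ)
      * max (cSt (profile P N) (min a 8 / (P.L : ℝ) ^ 2)
              (a * ((P.L : ℝ) ^ 2)⁻¹ * Real.exp (δ * ((P.L : ℝ) - 1)) + (4 * P.d + msq) * Real.exp δ) δ)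
            (cSt (profile P N) (min a (8 * gamma0 P a msq) / (P.L : ℝ) ^ 2)
              (a * ((P.L : ℝ) ^ 2)⁻¹ * Real.exp (δ * ((P.L : ℝ) - 1)) + a +
                a ^ 2 * (2 / min 8 (a * (1 - ((P.L : ℝ) ^ 2)⁻¹)) * Real.exp δ)) δ) with hcφ
  set rA := min (dSt (profile P P.d) (min a 8 / (P.L : ℝ) ^ 2)
              (a * ((P.L : ℝ) ^ 2)⁻¹ * Real.exp (δ * ((P.L : ℝ) - 1)) + (4 * P.d + μ0sq) * Real.exp δ) δ)
            (dSt (profile P P.d) (min a (8 * gamma0 P a μ0sq) / (P.L : ℝ) ^ 2)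
              (a * ((P.L : ℝ) ^ 2)⁻¹ * Real.exp (δ * ((P.L : ℝ) - 1)) + a +
                a ^ 2 * (2 / min 8 (a * (1 - ((P.L : ℝ) ^ 2)⁻¹)) * Real.exp δ)) δ) with hrA
  set rφ := min (dSt (profile P N) (min a 8 / (P.L : ℝ) ^ 2)
              (a * ((P.L : ℝ) ^ 2)⁻¹ * Real.exp (δ * ((P.L : ℝ) - 1)) + (4 * P.d + msq) * Real.exp δ) δ)
            (dSt (profile P N) (min a (8 * gamma0 P a msq) / (P.L : ℝ) ^ 2)
              (a * ((P.L : ℝ) ^ 2)⁻¹ * Real.exp (δ * ((P.L : ℝ) - 1)) + a +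
                a ^ 2 * (2 / min 8 (a * (1 - ((P.L : ℝ) ^ 2)⁻¹)) * Real.exp δ)) δ) with hrφ
  have hcA0 : 0 ≤ cA := by
    rw [hcA]
    exact mul_nonneg (Nat.cast_nonneg _) ((cSt_pos _ _ _ hγ0).le.trans (le_max_left _ _))
  have hcφ0 : 0 ≤ cφ := by
    rw [hcφ]
    exact mul_nonneg (Nat.cast_nonneg _) ((cSt_pos _ _ _ hγ0).le.trans (le_max_left _ _))
  have hrA0 : 0 < rA := by
    rw [hrA]
    exact lt_min (dSt_pos profile_nonneg' hγ0 (hκ0 μ0sq hμ) hδ0)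
      (dSt_pos profile_nonneg' (lowConst_pos ha hL hμ.le) hκ1 hδ0)
  have hrφ0 : 0 < rφ := by
    rw [hrφ]
    exact lt_min (dSt_pos profile_nonneg' hγ0 (hκ0 msq hmsq) hδ0)
      (dSt_pos profile_nonneg' (lowConst_pos ha hL hmsq.le) hκ1 hδ0)
  have hsk : 0 ≤ P.mesh k ^ (-((P.d : ℝ) - 2)) := Real.rpow_nonneg (P.mesh_pos k).le _
  refine abs_cumulantOf_rv357_le_of_ineq234 C Finset.univ 0 hμ hmsq ha hLr hk.le qmax coef hA₀ hδ₀ hcA0 (lt_min hrA0 hrφ0) h358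
    (fun b b' => ?_) (fun y y' j j' => ?_)
  · have h := pairing234A_zeroField (P := P) ha hL hμ hk hs hδ0 hδ b b'
    rw [← hcA, ← hrA] at h
    have ht : 0 ≤ (HiggsLattice.Site.tdist b.src b'.src : ℝ) := Nat.cast_nonneg _
    calc _ ≤ _ := h
      _ = 1 * cA * P.mesh k ^ (-((P.d : ℝ) - 2)) * Real.exp (-(rA * (HiggsLattice.Site.tdist b.src b'.src : ℝ))) := by ring
      _ ≤ 1 * cA * P.mesh k ^ (-((P.d : ℝ) - 2)) * Real.exp (-(min rA rφ * (HiggsLattice.Site.tdist b.src b'.src : ℝ))) :=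
          weaken_decay zero_le_one hsk le_rfl hcA0 (min_le_left _ _) ht
      _ = _ := by ring
  · have h := pairing234_zeroField C ha hL hmsq hk hs hδ0 hδ y y' j j'
    rw [← hcφ, ← hrφ] at h
    have ht : 0 ≤ (HiggsLattice.Site.tdist y y' : ℝ) := Nat.cast_nonneg _
    calc _ ≤ _ := h
      _ = 1 * cφ * P.mesh k ^ (-((P.d : ℝ) - 2)) * Real.exp (-(rφ * (HiggsLattice.Site.tdist y y' : ℝ))) := by ring
      _ ≤ 1 * cφ * P.mesh k ^ (-((P.d : ℝ) - 2)) * Real.exp (-(min rA rφ * (HiggsLattice.Site.tdist y y' : ℝ))) :=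
          weaken_decay zero_le_one hsk le_rfl hcφ0 (min_le_right _ _) ht
      _ = _ := by ring

/-- **THE SCALE FORM** — (3.58) as printed, `|v^{(k)}(q;z;κ)| ≦ O(1)(L^kε)^{κ₀}exp(−δ₀d(z))` (`A₀ = C_v(L^kε)^{κ₀}`):
`|⟨(V^{(k)})ⁿ⟩^T| ≤ connConst·C_vⁿ·(L^kε)^{nκ₀}·|T^{(k)}|` at zero background on the whole torus with NO propagator hypothesis — print's
*"Hence ⟨Vⁿ⟩^T = O(ε^κ)|T₁| with κ > d for n sufficiently large"* (`κ = nκ₀`; `connConst`, `C_v` independent of `k`, `ε`, the volume).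
[cite: Balaban1982Higgs1, (3.23) p.616; Prop. 3.2 (3.58) p.622] -/
theorem abs_cumulantOf_rv357_le_zeroField_scale (hμ : 0 < μ0sq) (hmsq : 0 < msq) (ha : 0 < a) (hL : 1 < P.L)
    {k : ℕ} (hk : k < P.K) (hs : P.mesh k ≤ 1)
    {δ : ℝ} (hδ0 : 0 < δ) (hδ : (4 * P.d + 4 * a) * δ ≤ min 8 (a * (1 - ((P.L : ℝ) ^ 2)⁻¹)))
    (qmax : ℕ) (coef : (q : ℕ) → (Fin q → HiggsLattice.Site P k) → (Fin q → Leg N P.d) → ℝ) {n : ℕ} [NeZero n]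
    {Cv κ₀ δ₀ : ℝ} (hCv : 0 ≤ Cv) (hδ₀ : 0 < δ₀)
    (h358 : ∀ q, q ≤ qmax → ∀ (z : Fin q → HiggsLattice.Site P k) (κ : Fin q → Leg N P.d),
      |coef q z κ| ≤ Cv * P.mesh k ^ κ₀ * Real.exp (-(δ₀ * (diam z : ℝ)))) :
    |cumulantOf (nmoment (rv357 k qmax coef) (law356 C Finset.univ (0 : HiggsLattice.VecField P 0) μ0sq msq a k)) n|
      ≤ connConst P.d (N + P.d) n qmax
            (max ((P.d : ℝ)
                    * max (cSt (profile P P.d) (min a 8 / (P.L : ℝ) ^ 2)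
                            (a * ((P.L : ℝ) ^ 2)⁻¹ * Real.exp (δ * ((P.L : ℝ) - 1)) + (4 * P.d + μ0sq) * Real.exp δ) δ)
                          (cSt (profile P P.d) (min a (8 * gamma0 P a μ0sq) / (P.L : ℝ) ^ 2)
                            (a * ((P.L : ℝ) ^ 2)⁻¹ * Real.exp (δ * ((P.L : ℝ) - 1)) + a +
                              a ^ 2 * (2 / min 8 (a * (1 - ((P.L : ℝ) ^ 2)⁻¹)) * Real.exp δ)) δ))
                 ((N : ℝ)
                    * max (cSt (profile P N) (min a 8 / (P.L : ℝ) ^ 2)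
                            (a * ((P.L : ℝ) ^ 2)⁻¹ * Real.exp (δ * ((P.L : ℝ) - 1)) + (4 * P.d + msq) * Real.exp δ) δ)
                          (cSt (profile P N) (min a (8 * gamma0 P a msq) / (P.L : ℝ) ^ 2)
                            (a * ((P.L : ℝ) ^ 2)⁻¹ * Real.exp (δ * ((P.L : ℝ) - 1)) + a +
                              a ^ 2 * (2 / min 8 (a * (1 - ((P.L : ℝ) ^ 2)⁻¹)) * Real.exp δ)) δ)))
            δ₀
            (min (min (dSt (profile P P.d) (min a 8 / (P.L : ℝ) ^ 2)
                        (a * ((P.L : ℝ) ^ 2)⁻¹ * Real.exp (δ * ((P.L : ℝ) - 1)) + (4 * P.d + μ0sq) * Real.exp δ) δ)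
                      (dSt (profile P P.d) (min a (8 * gamma0 P a μ0sq) / (P.L : ℝ) ^ 2)
                        (a * ((P.L : ℝ) ^ 2)⁻¹ * Real.exp (δ * ((P.L : ℝ) - 1)) + a +
                          a ^ 2 * (2 / min 8 (a * (1 - ((P.L : ℝ) ^ 2)⁻¹)) * Real.exp δ)) δ))
                 (min (dSt (profile P N) (min a 8 / (P.L : ℝ) ^ 2)
                        (a * ((P.L : ℝ) ^ 2)⁻¹ * Real.exp (δ * ((P.L : ℝ) - 1)) + (4 * P.d + msq) * Real.exp δ) δ)
                      (dSt (profile P N) (min a (8 * gamma0 P a msq) / (P.L : ℝ) ^ 2)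
                        (a * ((P.L : ℝ) ^ 2)⁻¹ * Real.exp (δ * ((P.L : ℝ) - 1)) + a +
                          a ^ 2 * (2 / min 8 (a * (1 - ((P.L : ℝ) ^ 2)⁻¹)) * Real.exp δ)) δ)))
        * Cv ^ n * P.mesh k ^ (κ₀ * n) * Fintype.card (HiggsLattice.Site P k) := by
  have hsk : 0 ≤ P.mesh k := (P.mesh_pos k).le
  have h := abs_cumulantOf_rv357_le_zeroField (n := n) C hμ hmsq ha hL hk hs hδ0 hδ qmax coef
    (mul_nonneg hCv (Real.rpow_nonneg hsk κ₀)) hδ₀ h358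
  rw [mul_pow, ← Real.rpow_mul_natCast hsk] at h
  calc _ ≤ _ := h
    _ = _ := by ring

/-- **(3.23) AT ZERO BACKGROUND ON THE WHOLE TORUS, PRINTED (EXISTENTIAL) SHAPE**: for `d`, `L ≥ 2`, `N`, `a, μ₀², m² > 0` there are `c ≥ 0`, `δ₁ > 0`
(functions of these data only) such that on EVERY torus of the model with these `d, L`, for every coupling `C`, every level `0 ≤ k < K` with
`L^kε ≤ 1`, every `n ≥ 1` and every displayed `V^{(k)}` obeying (3.58) with `(A₀, δ₀)`:
`|⟨(V^{(k)})ⁿ⟩^T| ≤ connConst(d, N+d, n, q_max, c, δ₀, δ₁)·A₀ⁿ·|T^{(k)}|` — the rate parameter of the (2.34) engine fixed at its admissible value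
`δ = min{8, a(1−L^{−2})}/(4d+4a)`. [cite: Balaban1982Higgs1, (3.23) p.616; Prop. 2.3 (2.34) p.611; Prop. 3.2 (3.58) p.622] -/
theorem abs_cumulantOf_rv357_le_zeroField_printed (d L N : ℕ) (hL : 1 < L) {a μ0sq msq : ℝ} (ha : 0 < a) (hμ : 0 < μ0sq)
    (hmsq : 0 < msq) :
    ∃ c δ₁ : ℝ, 0 ≤ c ∧ 0 < δ₁ ∧ ∀ (P : HiggsLattice.Params), P.d = d → P.L = L →
      ∀ (C : ChargeData N) (k : ℕ), k < P.K → P.mesh k ≤ 1 →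
        ∀ (qmax : ℕ) (coef : (q : ℕ) → (Fin q → HiggsLattice.Site P k) → (Fin q → Leg N P.d) → ℝ) (n : ℕ) [NeZero n]
          (A₀ δ₀ : ℝ), 0 ≤ A₀ → 0 < δ₀ →
          (∀ q, q ≤ qmax → ∀ (z : Fin q → HiggsLattice.Site P k) (κ : Fin q → Leg N P.d),
              |coef q z κ| ≤ A₀ * Real.exp (-(δ₀ * (diam z : ℝ)))) →
          |cumulantOf (nmoment (rv357 k qmax coef) (law356 C Finset.univ (0 : HiggsLattice.VecField P 0) μ0sq msq a k)) n|
            ≤ connConst d (N + d) n qmax c δ₀ δ₁ * A₀ ^ n * Fintype.card (HiggsLattice.Site P k) := by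
  -- the admissible rate parameter and the P-free spellings of the constants of `abs_cumulantOf_rv357_le_zeroField`
  have hL1 : (1 : ℝ) < (L : ℝ) := by exact_mod_cast hL
  have hL0 : (0 : ℝ) < (L : ℝ) := by linarith
  have hLi : ((L : ℝ) ^ 2)⁻¹ < 1 := inv_lt_one_of_one_lt₀ (by nlinarith)
  have hγZ : 0 < min 8 (a * (1 - ((L : ℝ) ^ 2)⁻¹)) := lt_min (by norm_num) (mul_pos ha (by linarith))
  set δ : ℝ := min 8 (a * (1 - ((L : ℝ) ^ 2)⁻¹)) / (4 * d + 4 * a) with hδdef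
  have hden : 0 < 4 * (d : ℝ) + 4 * a := by positivity
  have hδ0 : 0 < δ := div_pos hγZ hden
  have hδ : (4 * (d : ℝ) + 4 * a) * δ ≤ min 8 (a * (1 - ((L : ℝ) ^ 2)⁻¹)) := by
    rw [hδdef, mul_div_cancel₀ _ hden.ne']
  have hγ0 : 0 < min a 8 / (L : ℝ) ^ 2 := div_pos (lt_min ha (by norm_num)) (pow_pos hL0 2)
  have hg : ∀ m : ℝ, 0 < m → 0 < min (a * (1 - ((L : ℝ) ^ 2)⁻¹) / (8 * d + 2 * m)) (1 / 4) := by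
    intro m hm
    exact lt_min (div_pos (mul_pos ha (by linarith)) (by positivity)) (by norm_num)
  have hγ1 : ∀ m : ℝ, 0 < m → 0 < min a (8 * min (a * (1 - ((L : ℝ) ^ 2)⁻¹) / (8 * d + 2 * m)) (1 / 4)) / (L : ℝ) ^ 2 := by
    intro m hm
    exact div_pos (lt_min ha (by linarith [hg m hm])) (pow_pos hL0 2)
  have hκ0 : ∀ m : ℝ, 0 < m → 0 ≤ a * ((L : ℝ) ^ 2)⁻¹ * Real.exp (δ * ((L : ℝ) - 1)) + (4 * d + m) * Real.exp δ := by
    intro m hm; positivity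
  have hκ1 : 0 ≤ a * ((L : ℝ) ^ 2)⁻¹ * Real.exp (δ * ((L : ℝ) - 1)) + a +
      a ^ 2 * (2 / min 8 (a * (1 - ((L : ℝ) ^ 2)⁻¹)) * Real.exp δ) := by positivity
  have hKd : ∀ M : ℕ, ∀ t : ℝ, 0 < t → 0 ≤ (B1Ineq234Concrete.nCol M : ℝ) * B4Sect5Proof.latticeConst d t :=
    fun M => B4Sect5Torus.profile_nonneg d (B1Ineq234Concrete.nCol M)
  refine ⟨max ((d : ℝ)
        * max (cSt (fun t => (B1Ineq234Concrete.nCol d : ℝ) * B4Sect5Proof.latticeConst d t) (min a 8 / (L : ℝ) ^ 2)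
                (a * ((L : ℝ) ^ 2)⁻¹ * Real.exp (δ * ((L : ℝ) - 1)) + (4 * d + μ0sq) * Real.exp δ) δ)
              (cSt (fun t => (B1Ineq234Concrete.nCol d : ℝ) * B4Sect5Proof.latticeConst d t)
                (min a (8 * min (a * (1 - ((L : ℝ) ^ 2)⁻¹) / (8 * d + 2 * μ0sq)) (1 / 4)) / (L : ℝ) ^ 2)
                (a * ((L : ℝ) ^ 2)⁻¹ * Real.exp (δ * ((L : ℝ) - 1)) + a +
                  a ^ 2 * (2 / min 8 (a * (1 - ((L : ℝ) ^ 2)⁻¹)) * Real.exp δ)) δ))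
      ((N : ℝ)
        * max (cSt (fun t => (B1Ineq234Concrete.nCol N : ℝ) * B4Sect5Proof.latticeConst d t) (min a 8 / (L : ℝ) ^ 2)
                (a * ((L : ℝ) ^ 2)⁻¹ * Real.exp (δ * ((L : ℝ) - 1)) + (4 * d + msq) * Real.exp δ) δ)
              (cSt (fun t => (B1Ineq234Concrete.nCol N : ℝ) * B4Sect5Proof.latticeConst d t)
                (min a (8 * min (a * (1 - ((L : ℝ) ^ 2)⁻¹) / (8 * d + 2 * msq)) (1 / 4)) / (L : ℝ) ^ 2)
                (a * ((L : ℝ) ^ 2)⁻¹ * Real.exp (δ * ((L : ℝ) - 1)) + a +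
                  a ^ 2 * (2 / min 8 (a * (1 - ((L : ℝ) ^ 2)⁻¹)) * Real.exp δ)) δ)),
    min (min (dSt (fun t => (B1Ineq234Concrete.nCol d : ℝ) * B4Sect5Proof.latticeConst d t) (min a 8 / (L : ℝ) ^ 2)
                (a * ((L : ℝ) ^ 2)⁻¹ * Real.exp (δ * ((L : ℝ) - 1)) + (4 * d + μ0sq) * Real.exp δ) δ)
              (dSt (fun t => (B1Ineq234Concrete.nCol d : ℝ) * B4Sect5Proof.latticeConst d t)
                (min a (8 * min (a * (1 - ((L : ℝ) ^ 2)⁻¹) / (8 * d + 2 * μ0sq)) (1 / 4)) / (L : ℝ) ^ 2)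
                (a * ((L : ℝ) ^ 2)⁻¹ * Real.exp (δ * ((L : ℝ) - 1)) + a +
                  a ^ 2 * (2 / min 8 (a * (1 - ((L : ℝ) ^ 2)⁻¹)) * Real.exp δ)) δ))
      (min (dSt (fun t => (B1Ineq234Concrete.nCol N : ℝ) * B4Sect5Proof.latticeConst d t) (min a 8 / (L : ℝ) ^ 2)
                (a * ((L : ℝ) ^ 2)⁻¹ * Real.exp (δ * ((L : ℝ) - 1)) + (4 * d + msq) * Real.exp δ) δ)
              (dSt (fun t => (B1Ineq234Concrete.nCol N : ℝ) * B4Sect5Proof.latticeConst d t)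
                (min a (8 * min (a * (1 - ((L : ℝ) ^ 2)⁻¹) / (8 * d + 2 * msq)) (1 / 4)) / (L : ℝ) ^ 2)
                (a * ((L : ℝ) ^ 2)⁻¹ * Real.exp (δ * ((L : ℝ) - 1)) + a +
                  a ^ 2 * (2 / min 8 (a * (1 - ((L : ℝ) ^ 2)⁻¹)) * Real.exp δ)) δ)),
    ?_, ?_, fun P hPd hPL C k hk hs qmax coef n _ A₀ δ₀ hA₀ hδ₀ h358 => ?_⟩
  · exact le_max_of_le_left (mul_nonneg (Nat.cast_nonneg d) ((cSt_pos _ _ _ hγ0).le.trans (le_max_left _ _)))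
  · exact lt_min
      (lt_min (dSt_pos (hKd d) hγ0 (hκ0 μ0sq hμ) hδ0) (dSt_pos (hKd d) (hγ1 μ0sq hμ) hκ1 hδ0))
      (lt_min (dSt_pos (hKd N) hγ0 (hκ0 msq hmsq) hδ0) (dSt_pos (hKd N) (hγ1 msq hmsq) hκ1 hδ0))
  · subst hPd; subst hPL
    have hPL : 1 < P.L := hL
    have hδ' : (4 * (P.d : ℝ) + 4 * a) * δ ≤ min 8 (a * (1 - ((P.L : ℝ) ^ 2)⁻¹)) := hδ
    exact abs_cumulantOf_rv357_le_zeroField C hμ hmsq ha hPL hk hs hδ0 hδ' qmax coef hA₀ hδ₀ h358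

end Cumulant

/-! ## §4 Level `0` with a regular background `B^{(1)}` on the whole torus (the setting of the first step (3.24)/(3.25), p. 616) -/

section Regular

open B4Sect5Torus (cSt dSt cSt_pos dSt_pos)
open B1Ineq234Concrete (profile profile_nonneg' ineq234_concrete)
open B1Ineq234ZeroFieldRegionUniform (decay_transfer profile_anti kerConst_levelZero_eq kerConst_levelZero_le)
open B1Ineq234LevelZero (hker_precOpA_levelZero)
open B1Ineq233LowerBackgroundTorus (ineq233_lower_regular_torus_levelZero)
open B1Ineq234BackgroundTorus (two_le_sitesPerDir)
open B1Prop32InteractionBound (Leg)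
open B1Ineq358TreeDecaySum (diam)
open Literature.Probability.LatticeModels (cumulantOf)
open B10Eq24Cumulant (nmoment)
open B1Eq323ConnectedGraphBound (connConst)
open B1Eq357FluctuationPolynomial (law356 rv357)
open B1Eq323DisplayedCumulantBound (abs_cumulantOf_rv357_le_of_ineq234)

variable (C : ChargeData N) {a msq μ0sq : ℝ}

/-- **(2.34) AT LEVEL `0` FOR A REGULAR BACKGROUND ON THE WHOLE TORUS, CONSTANTS UNIFORM IN `ε ≤ 1`** (entrywise, `mat` currency): for
`a, m² > 0`, `0 < K`, `ε ≤ 1`, a background `B` on `T_ε` with `|B(⟨z+e_ν, μ′⟩) − B(⟨z, μ′⟩)| ≤ r` and `L²d·(2dLε|e|r)² ≤ 1`, every rate `δ > 0`,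
every `Λ ⊂ T_ε` and index pairs over `Λ`: `|C^{(0),ε}_Λ(T_ε, B; p, q)| ≤ ε²·c₁·e^{−δ₁|x_p − x_q|}` with
`(c₁, δ₁) = (cSt, dSt)(N·K_d; 3min{a,4}/(4L²), aL^{−2}e^{δ(L−1)} + (4d+m²)e^{δ}, δ)` — the Sect.-5 engine `ineq234_concrete` fed with r14's level-`0`
lower half (2.33)ₗ at a regular background `B1Ineq233LowerBackgroundTorus.ineq233_lower_regular_torus_levelZero` (no-wrap hypothesis automatic,
`two_le_sitesPerDir`) and the level-`0` kernel bound (5.4) `hker_precOpA_levelZero` (every background), transported by r14 g9's `decay_transfer`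
exactly as in `ineq234_zeroField_region_levelZero_uniform`. [cite: Balaban1982Higgs1, Prop. 2.3 (2.34) p.611; (2.23) p.610] -/
theorem ineq234_regular_torus_levelZero_uniform (ha : 0 < a) (hmsq : 0 < msq) (hK : 0 < P.K) (hs : P.mesh 0 ≤ 1)
    (B : HiggsLattice.VecField P 0) {r : ℝ} (hr : 0 ≤ r)
    (hreg : ∀ (z : HiggsLattice.Site P 0) (μ' ν : Fin P.d), |B ⟨z.shift ν, μ'⟩ - B ⟨z, μ'⟩| ≤ r)
    (hθ : (P.L : ℝ) ^ 2 * P.d * (2 * P.d * P.L * (P.mesh 0 * |C.e|) * r) ^ 2 ≤ 1) {δ : ℝ} (hδ : 0 < δ)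
    (Λ : Finset (HiggsLattice.Site P 0)) {p q : HiggsLattice.Site P 0 × Ix N} (hp : p.1 ∈ Λ) (hq : q.1 ∈ Λ) :
    |mat (condCov232 C Finset.univ B msq a 0 Λ) p q| ≤
      P.mesh 0 ^ 2 *
        cSt (profile P N) (3 * (min a 4 / (P.L : ℝ) ^ 2) / 4)
          (a * ((P.L : ℝ) ^ 2)⁻¹ * Real.exp (δ * ((P.L : ℝ) - 1)) + (4 * P.d + msq) * Real.exp δ) δ *
        Real.exp (-(dSt (profile P N) (3 * (min a 4 / (P.L : ℝ) ^ 2) / 4)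
          (a * ((P.L : ℝ) ^ 2)⁻¹ * Real.exp (δ * ((P.L : ℝ) - 1)) + (4 * P.d + msq) * Real.exp δ) δ *
          (HiggsLattice.Site.tdist p.1 q.1 : ℝ))) := by
  set γu := 3 * (min a 4 / (P.L : ℝ) ^ 2) / 4 with hγu
  set ck := a * ((P.L : ℝ) ^ 2)⁻¹ * Real.exp (δ * ((P.L : ℝ) - 1)) + (4 * P.d + msq * P.mesh 0 ^ 2) * Real.exp δ
    with hck
  set s := (P.mesh 0)⁻¹ ^ 2 with hsdef
  have hM : 0 < P.mesh 0 := P.mesh_pos _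
  have hL0 : (0 : ℝ) < P.L := by exact_mod_cast (lt_of_lt_of_le Nat.zero_lt_one P.hL)
  have hγ : 0 < γu := by
    have : 0 < min a 4 := lt_min ha (by norm_num)
    positivity
  have hck0 : 0 < ck := by
    have hd : (0 : ℝ) ≤ P.d := Nat.cast_nonneg _
    rw [hck]
    positivity
  have hs1 : 1 ≤ s := by
    rw [hsdef, inv_pow]
    exact one_le_inv_iff₀.mpr ⟨by positivity, by nlinarith⟩
  have hs0 : 0 < s := by linarith
  have hN2 : ∀ μ, 2 ≤ P.sitesPerDir 1 μ := fun μ => two_le_sitesPerDir P 1 μ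
  have main := ineq234_concrete C Finset.univ B msq a (mul_pos hγ hs0) (mul_pos hck0 hs0) hδ
    (fun f => by
      have h := ineq233_lower_regular_torus_levelZero C ha.le hmsq.le hK hN2 B hr hreg hθ f
      rw [hγu, hsdef]
      linarith [h])
    (fun p q => by
      have h := hker_precOpA_levelZero C Finset.univ B msq a hK ha.le hmsq.le hδ.le p q
      rw [kerConst_levelZero_eq] at h
      rw [hck, hsdef]; exact h)
    Λ hp hq
  have ht : 0 ≤ (HiggsLattice.Site.tdist p.1 q.1 : ℝ) := Nat.cast_nonneg _
  have htr := decay_transfer (K := profile P N) profile_nonneg' profile_anti hγ hck0.le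
    (kerConst_levelZero_le (P := P) a hmsq.le hs δ) hδ hs1 ht
  have hsinv : s⁻¹ = P.mesh 0 ^ 2 := by rw [hsdef, inv_pow, inv_inv]
  rw [hsinv] at htr
  calc _ ≤ _ := main
    _ ≤ _ := htr
    _ = _ := by ring

/-- The same in the pairing (1.5) at point sources (r14's `h234φ` shape): `|⟨δ_{y,j}, C^{(0)}_{T_ε}(T_ε, B)δ_{y′,j′}⟩| ≤ N·c₁·ε^{−(d−2)}·e^{−δ₁|y−y′|}`,
`(c₁, δ₁)` of `ineq234_regular_torus_levelZero_uniform`. [cite: Balaban1982Higgs1, Prop. 2.3 (2.34) p.611; (2.23) p.610] -/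
theorem pairing234_levelZero_regular (ha : 0 < a) (hmsq : 0 < msq) (hK : 0 < P.K) (hs : P.mesh 0 ≤ 1)
    (B : HiggsLattice.VecField P 0) {r : ℝ} (hr : 0 ≤ r)
    (hreg : ∀ (z : HiggsLattice.Site P 0) (μ' ν : Fin P.d), |B ⟨z.shift ν, μ'⟩ - B ⟨z, μ'⟩| ≤ r)
    (hθ : (P.L : ℝ) ^ 2 * P.d * (2 * P.d * P.L * (P.mesh 0 * |C.e|) * r) ^ 2 ≤ 1) {δ : ℝ} (hδ : 0 < δ)
    (y y' : HiggsLattice.Site P 0) (j j' : Fin N) :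
    |siteInner (siteDelta y j)
        (condCov232 C Finset.univ B msq a 0 (Finset.univ : Finset (HiggsLattice.Site P 0)) (siteDelta y' j'))|
      ≤ (N : ℝ) * cSt (profile P N) (3 * (min a 4 / (P.L : ℝ) ^ 2) / 4)
            (a * ((P.L : ℝ) ^ 2)⁻¹ * Real.exp (δ * ((P.L : ℝ) - 1)) + (4 * P.d + msq) * Real.exp δ) δ
          * P.mesh 0 ^ (-((P.d : ℝ) - 2))
          * Real.exp (-(dSt (profile P N) (3 * (min a 4 / (P.L : ℝ) ^ 2) / 4)
              (a * ((P.L : ℝ) ^ 2)⁻¹ * Real.exp (δ * ((P.L : ℝ) - 1)) + (4 * P.d + msq) * Real.exp δ) δ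
              * (HiggsLattice.Site.tdist y y' : ℝ))) := by
  set c := cSt (profile P N) (3 * (min a 4 / (P.L : ℝ) ^ 2) / 4)
    (a * ((P.L : ℝ) ^ 2)⁻¹ * Real.exp (δ * ((P.L : ℝ) - 1)) + (4 * P.d + msq) * Real.exp δ) δ with hc
  set ρ := dSt (profile P N) (3 * (min a 4 / (P.L : ℝ) ^ 2) / 4)
    (a * ((P.L : ℝ) ^ 2)⁻¹ * Real.exp (δ * ((P.L : ℝ) - 1)) + (4 * P.d + msq) * Real.exp δ) δ with hρ
  have hL0 : (0 : ℝ) < P.L := by exact_mod_cast (lt_of_lt_of_le Nat.zero_lt_one P.hL)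
  have hγ : 0 < 3 * (min a 4 / (P.L : ℝ) ^ 2) / 4 := by
    have : 0 < min a 4 := lt_min ha (by norm_num)
    positivity
  have hc0 : 0 < c := cSt_pos _ _ _ hγ
  have hm : 0 < P.mesh 0 := P.mesh_pos 0
  have hmat : ∀ i i' : Ix N,
      |mat (condCov232 C Finset.univ B msq a 0 (Finset.univ : Finset (HiggsLattice.Site P 0))) (y, i) (y', i')|
        ≤ P.mesh 0 ^ 2 * c * Real.exp (-(ρ * (HiggsLattice.Site.tdist y y' : ℝ))) :=
    fun i i' => ineq234_regular_torus_levelZero_uniform C ha hmsq hK hs B hr hreg hθ hδ Finset.univ (p := (y, i)) (q := (y', i'))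
      (Finset.mem_univ _) (Finset.mem_univ _)
  have h := abs_siteInner_siteDelta_le_of_mat _ y y' (by positivity) hmat j j'
  calc _ ≤ _ := h
    _ = (N : ℝ) * c * ((P.mesh 0 ^ P.d)⁻¹ * P.mesh 0 ^ 2) * Real.exp (-(ρ * (HiggsLattice.Site.tdist y y' : ℝ))) := by ring
    _ = _ := by rw [mesh_pow_inv_mul_sq]

/-- **(3.23) FOR THE DISPLAYED `V^{(0)}` OF THE FIRST STEP, REGULAR BACKGROUND `B^{(1)}` ON THE WHOLE TORUS, NO PROPAGATOR HYPOTHESIS**: for the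
measure `dμ_{C^{(0)}}(A′)dμ_{C^{(0)}(B^{(1)})}(φ′)` of (3.23)/(3.24) (p. 616) with `B^{(1)}` `r`-regular on `T_ε` (`|B(⟨z+e_ν,μ′⟩) − B(⟨z,μ′⟩)| ≤ r`,
`L²d(2dLε|e|r)² ≤ 1`), `μ₀², m² > 0`, `a > 0`, `L > 1`, `0 < K`, `ε ≤ 1`, any rate `δ > 0`, `n ≥ 1`, and (3.58) in the diameter currency ONLY:
`|⟨(V^{(0)})ⁿ⟩^T| ≤ connConst(d, N+d, n, q_max, max(d·c_A, N·c_B), δ₀, min(δ_A, δ_B))·A₀ⁿ·|T_ε|` — vector factor from `pairing234_levelZero_zeroField`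
(`N = d`, `m² = μ₀²`), scalar factor from `pairing234_levelZero_regular`; r14's `abs_cumulantOf_rv357_le_of_ineq234` with both inputs DISCHARGED.
[cite: Balaban1982Higgs1, (3.23) p.616; Prop. 2.3 (2.34) p.611; (2.23) p.610; Prop. 3.2 (3.58) p.622] -/
theorem abs_cumulantOf_rv357_le_levelZero_regular (hμ : 0 < μ0sq) (hmsq : 0 < msq) (ha : 0 < a) (hL : 1 < P.L)
    (hK : 0 < P.K) (hs : P.mesh 0 ≤ 1) (B : HiggsLattice.VecField P 0) {r : ℝ} (hr : 0 ≤ r)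
    (hreg : ∀ (z : HiggsLattice.Site P 0) (μ' ν : Fin P.d), |B ⟨z.shift ν, μ'⟩ - B ⟨z, μ'⟩| ≤ r)
    (hθ : (P.L : ℝ) ^ 2 * P.d * (2 * P.d * P.L * (P.mesh 0 * |C.e|) * r) ^ 2 ≤ 1) {δ : ℝ} (hδ0 : 0 < δ)
    (qmax : ℕ) (coef : (q : ℕ) → (Fin q → HiggsLattice.Site P 0) → (Fin q → Leg N P.d) → ℝ) {n : ℕ} [NeZero n]
    {A₀ δ₀ : ℝ} (hA₀ : 0 ≤ A₀) (hδ₀ : 0 < δ₀)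
    (h358 : ∀ q, q ≤ qmax → ∀ (z : Fin q → HiggsLattice.Site P 0) (κ : Fin q → Leg N P.d),
      |coef q z κ| ≤ A₀ * Real.exp (-(δ₀ * (diam z : ℝ)))) :
    |cumulantOf (nmoment (rv357 0 qmax coef) (law356 C Finset.univ B μ0sq msq a 0)) n|
      ≤ connConst P.d (N + P.d) n qmax
            (max ((P.d : ℝ) * cSt (profile P P.d) (min a 8 / (P.L : ℝ) ^ 2)
                    (a * ((P.L : ℝ) ^ 2)⁻¹ * Real.exp (δ * ((P.L : ℝ) - 1)) + (4 * P.d + μ0sq) * Real.exp δ) δ)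
                 ((N : ℝ) * cSt (profile P N) (3 * (min a 4 / (P.L : ℝ) ^ 2) / 4)
                    (a * ((P.L : ℝ) ^ 2)⁻¹ * Real.exp (δ * ((P.L : ℝ) - 1)) + (4 * P.d + msq) * Real.exp δ) δ))
            δ₀
            (min (dSt (profile P P.d) (min a 8 / (P.L : ℝ) ^ 2)
                    (a * ((P.L : ℝ) ^ 2)⁻¹ * Real.exp (δ * ((P.L : ℝ) - 1)) + (4 * P.d + μ0sq) * Real.exp δ) δ)
                 (dSt (profile P N) (3 * (min a 4 / (P.L : ℝ) ^ 2) / 4)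
                    (a * ((P.L : ℝ) ^ 2)⁻¹ * Real.exp (δ * ((P.L : ℝ) - 1)) + (4 * P.d + msq) * Real.exp δ) δ))
        * A₀ ^ n * Fintype.card (HiggsLattice.Site P 0) := by
  have hLr : (1 : ℝ) < (P.L : ℝ) := by exact_mod_cast hL
  have hL0 : (0 : ℝ) < (P.L : ℝ) := by linarith
  have hγ0 : 0 < min a 8 / (P.L : ℝ) ^ 2 := div_pos (lt_min ha (by norm_num)) (pow_pos hL0 2)
  have hγr : 0 < 3 * (min a 4 / (P.L : ℝ) ^ 2) / 4 := by
    have : 0 < min a 4 := lt_min ha (by norm_num)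
    positivity
  have hκ0 : ∀ m : ℝ, 0 < m → 0 ≤ a * ((P.L : ℝ) ^ 2)⁻¹ * Real.exp (δ * ((P.L : ℝ) - 1)) + (4 * P.d + m) * Real.exp δ := by
    intro m hm; positivity
  set cA := (P.d : ℝ) * cSt (profile P P.d) (min a 8 / (P.L : ℝ) ^ 2)
      (a * ((P.L : ℝ) ^ 2)⁻¹ * Real.exp (δ * ((P.L : ℝ) - 1)) + (4 * P.d + μ0sq) * Real.exp δ) δ with hcA
  set cB := (N : ℝ) * cSt (profile P N) (3 * (min a 4 / (P.L : ℝ) ^ 2) / 4)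
      (a * ((P.L : ℝ) ^ 2)⁻¹ * Real.exp (δ * ((P.L : ℝ) - 1)) + (4 * P.d + msq) * Real.exp δ) δ with hcB
  set rA := dSt (profile P P.d) (min a 8 / (P.L : ℝ) ^ 2)
      (a * ((P.L : ℝ) ^ 2)⁻¹ * Real.exp (δ * ((P.L : ℝ) - 1)) + (4 * P.d + μ0sq) * Real.exp δ) δ with hrA
  set rB := dSt (profile P N) (3 * (min a 4 / (P.L : ℝ) ^ 2) / 4)
      (a * ((P.L : ℝ) ^ 2)⁻¹ * Real.exp (δ * ((P.L : ℝ) - 1)) + (4 * P.d + msq) * Real.exp δ) δ with hrB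
  have hcA0 : 0 ≤ cA := by rw [hcA]; exact mul_nonneg (Nat.cast_nonneg _) (cSt_pos _ _ _ hγ0).le
  have hcB0 : 0 ≤ cB := by rw [hcB]; exact mul_nonneg (Nat.cast_nonneg _) (cSt_pos _ _ _ hγr).le
  have hrA0 : 0 < rA := by rw [hrA]; exact dSt_pos profile_nonneg' hγ0 (hκ0 μ0sq hμ) hδ0
  have hrB0 : 0 < rB := by rw [hrB]; exact dSt_pos profile_nonneg' hγr (hκ0 msq hmsq) hδ0
  have hsk : 0 ≤ P.mesh 0 ^ (-((P.d : ℝ) - 2)) := Real.rpow_nonneg (P.mesh_pos 0).le _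
  refine abs_cumulantOf_rv357_le_of_ineq234 C Finset.univ B hμ hmsq ha hLr (Nat.zero_le _) qmax coef hA₀ hδ₀ hcA0
    (lt_min hrA0 hrB0) h358 (fun b b' => ?_) (fun y y' j j' => ?_)
  · have h := pairing234_levelZero_zeroField (zeroCharge P.d) ha hL hμ hK hs hδ0 b.src b'.src b.dir b'.dir
    rw [← toSite_bondDelta, ← toSite_bondDelta, ← fluctCov_eq_condCov232, ← hcA, ← hrA] at h
    have ht : 0 ≤ (HiggsLattice.Site.tdist b.src b'.src : ℝ) := Nat.cast_nonneg _
    calc _ ≤ _ := h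
      _ = 1 * cA * P.mesh 0 ^ (-((P.d : ℝ) - 2)) * Real.exp (-(rA * (HiggsLattice.Site.tdist b.src b'.src : ℝ))) := by ring
      _ ≤ 1 * cA * P.mesh 0 ^ (-((P.d : ℝ) - 2)) * Real.exp (-(min rA rB * (HiggsLattice.Site.tdist b.src b'.src : ℝ))) :=
          weaken_decay zero_le_one hsk le_rfl hcA0 (min_le_left _ _) ht
      _ = _ := by ring
  · have h := pairing234_levelZero_regular C ha hmsq hK hs B hr hreg hθ hδ0 y y' j j'
    rw [← hcB, ← hrB] at h
    have ht : 0 ≤ (HiggsLattice.Site.tdist y y' : ℝ) := Nat.cast_nonneg _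
    calc _ ≤ _ := h
      _ = 1 * cB * P.mesh 0 ^ (-((P.d : ℝ) - 2)) * Real.exp (-(rB * (HiggsLattice.Site.tdist y y' : ℝ))) := by ring
      _ ≤ 1 * cB * P.mesh 0 ^ (-((P.d : ℝ) - 2)) * Real.exp (-(min rA rB * (HiggsLattice.Site.tdist y y' : ℝ))) :=
          weaken_decay zero_le_one hsk le_rfl hcB0 (min_le_right _ _) ht
      _ = _ := by ring

end Regular

/-! ## §5 Levels `1 ≤ k < K` with the background `A^{(k),ε}` of (3.29) on the cube sub-family (the `k`-th step's own background) -/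

section Background

open B4Sect5Torus (cSt dSt cSt_pos dSt_pos)
open B1Ineq234Concrete (profile nCol)
open B1Eq31Concrete (bgVec)
open B1Eq211ZeroFieldTorus (Shape)
open B1TorusCubeCover (half)
open B1Ineq234BackgroundTorus (ineq234_236_bgVec_torus)
open B1Prop32InteractionBound (Leg)
open B1Ineq358TreeDecaySum (diam)
open Literature.Probability.LatticeModels (cumulantOf)
open B10Eq24Cumulant (nmoment)
open B1Eq323ConnectedGraphBound (connConst)
open B1Eq357FluctuationPolynomial (law356 rv357)
open B1Eq323DisplayedCumulantBound (abs_cumulantOf_rv357_le_of_ineq234)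

/-- **(3.23) FOR THE DISPLAYED `V^{(k)}` AT THE BACKGROUND `A^{(k),ε}` OF (3.29), LEVELS `1 ≤ k < K`, ON THE CUBE SUB-FAMILY, NO PROPAGATOR HYPOTHESIS**
(printed, existential shape): for `d ≥ 1`, odd `L > 1`, `a, μ₀², m² > 0`, `N`, `(e, q)` there are a cube-size threshold `K₀min`, a field-size function
`c_A : ℕ → ℝ_{>0}` and constants `c, δ₁ : ℕ → ℝ` (`c ≥ 0`, `δ₁ > 0`; functions of `(d, N, L, a, μ₀², m², e)` and the cube size `K₀` only) such that for
`K₀ ≥ K₀min`, on every torus of the sub-family `M·L′_μ = L^m` with `K₀ ∣ M`, at every level `1 ≤ k < K` with `3·L^kK₀ ≤ |T_ε|_μ` and `L^kε ≤ 1`, for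
every block field `A` on `T^{(k)}` with `|A(x)| ≤ r`, `r·L^kε ≤ c_A(K₀)`, every `n ≥ 1` and every displayed `V^{(k)}` obeying (3.58) with `(A₀, δ₀)`:
`|⟨(V^{(k)})ⁿ⟩^T| ≤ connConst(d, N+d, n, q_max, c(K₀), δ₀, δ₁(K₀))·A₀ⁿ·|T^{(k)}|` for the law `dμ_{C^{(k)}}(A′)dμ_{C^{(k)}(A^{(k),ε})}(φ′)` — r14's
`abs_cumulantOf_rv357_le_of_ineq234` with `h234φ` DISCHARGED from r14 g13's `B1Ineq234BackgroundTorus.ineq234_236_bgVec_torus` ((2.34) at the (3.29)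
background, scale-uniform constants) and `h234A` from `pairing234A_zeroField` (rate fixed at `min{8,a(1−L^{−2})}/(4d+4a)`).
[cite: Balaban1982Higgs1, (3.23) p.616; Prop. 2.3 (2.34) p.611; (3.29) p.617; Prop. 3.2 (3.58) p.622] -/
theorem abs_cumulantOf_rv357_le_bgVec_torus (d L : ℕ) (hd : 1 ≤ d) (hL : Odd L ∧ 1 < L) {a : ℝ} (ha : 0 < a) {μ0sq msq : ℝ}
    (hμ : 0 < μ0sq) (hmsq : 0 < msq) (N : ℕ) (C : ChargeData N) :
    ∃ K₀min : ℕ, ∃ cA c δ₁ : ℕ → ℝ, (∀ K₀, 0 < cA K₀ ∧ 0 ≤ c K₀ ∧ 0 < δ₁ K₀) ∧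
      ∀ K₀ : ℕ, K₀min ≤ K₀ →
      ∀ (P : HiggsLattice.Params) (_S : Shape P), P.d = d → P.L = L → K₀ ∣ P.M →
      ∀ {k : ℕ}, 1 ≤ k → k < P.K → (∀ μ, 3 * half P k K₀ ≤ P.sitesPerDir 0 μ) → P.mesh k ≤ 1 →
      ∀ {r : ℝ}, r * P.mesh k ≤ cA K₀ →
      ∀ A : HiggsLattice.VecField P k, (∀ x, ‖toSite A x‖ ≤ r) →
        ∀ (qmax : ℕ) (coef : (q : ℕ) → (Fin q → HiggsLattice.Site P k) → (Fin q → Leg N P.d) → ℝ) (n : ℕ) [NeZero n]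
          (A₀ δ₀ : ℝ), 0 ≤ A₀ → 0 < δ₀ →
          (∀ q, q ≤ qmax → ∀ (z : Fin q → HiggsLattice.Site P k) (κ : Fin q → Leg N P.d),
              |coef q z κ| ≤ A₀ * Real.exp (-(δ₀ * (diam z : ℝ)))) →
          |cumulantOf (nmoment (rv357 k qmax coef) (law356 C Finset.univ (bgVec (P := P) μ0sq a k A) μ0sq msq a k)) n|
            ≤ connConst d (N + d) n qmax (c K₀) δ₀ (δ₁ K₀) * A₀ ^ n * Fintype.card (HiggsLattice.Site P k) := by
  obtain ⟨K₀min, cA, c₁, δ₁, hpos, H⟩ := ineq234_236_bgVec_torus d L hd hL ha hμ hmsq N C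
  -- the admissible rate of the zero-field vector factor and the P-free spelling of its constants (`pairing234A_zeroField`)
  have hL1 : (1 : ℝ) < (L : ℝ) := by exact_mod_cast hL.2
  have hL0 : (0 : ℝ) < (L : ℝ) := by linarith
  have hLi : ((L : ℝ) ^ 2)⁻¹ < 1 := inv_lt_one_of_one_lt₀ (by nlinarith)
  have hγZ : 0 < min 8 (a * (1 - ((L : ℝ) ^ 2)⁻¹)) := lt_min (by norm_num) (mul_pos ha (by linarith))
  set δ : ℝ := min 8 (a * (1 - ((L : ℝ) ^ 2)⁻¹)) / (4 * d + 4 * a) with hδdef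
  have hden : 0 < 4 * (d : ℝ) + 4 * a := by positivity
  have hδ0 : 0 < δ := div_pos hγZ hden
  have hδ : (4 * (d : ℝ) + 4 * a) * δ ≤ min 8 (a * (1 - ((L : ℝ) ^ 2)⁻¹)) := by
    rw [hδdef, mul_div_cancel₀ _ hden.ne']
  have hγ0 : 0 < min a 8 / (L : ℝ) ^ 2 := div_pos (lt_min ha (by norm_num)) (pow_pos hL0 2)
  have hg : 0 < min (a * (1 - ((L : ℝ) ^ 2)⁻¹) / (8 * d + 2 * μ0sq)) (1 / 4) :=
    lt_min (div_pos (mul_pos ha (by linarith)) (by positivity)) (by norm_num)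
  have hγ1 : 0 < min a (8 * min (a * (1 - ((L : ℝ) ^ 2)⁻¹) / (8 * d + 2 * μ0sq)) (1 / 4)) / (L : ℝ) ^ 2 :=
    div_pos (lt_min ha (by linarith)) (pow_pos hL0 2)
  have hκ0 : 0 ≤ a * ((L : ℝ) ^ 2)⁻¹ * Real.exp (δ * ((L : ℝ) - 1)) + (4 * d + μ0sq) * Real.exp δ := by positivity
  have hκ1 : 0 ≤ a * ((L : ℝ) ^ 2)⁻¹ * Real.exp (δ * ((L : ℝ) - 1)) + a +
      a ^ 2 * (2 / min 8 (a * (1 - ((L : ℝ) ^ 2)⁻¹)) * Real.exp δ) := by positivity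
  have hKd : ∀ t : ℝ, 0 < t → 0 ≤ (nCol d : ℝ) * B4Sect5Proof.latticeConst d t := B4Sect5Torus.profile_nonneg d (nCol d)
  set cV : ℝ := (d : ℝ)
      * max (cSt (fun t => (nCol d : ℝ) * B4Sect5Proof.latticeConst d t) (min a 8 / (L : ℝ) ^ 2)
              (a * ((L : ℝ) ^ 2)⁻¹ * Real.exp (δ * ((L : ℝ) - 1)) + (4 * d + μ0sq) * Real.exp δ) δ)
            (cSt (fun t => (nCol d : ℝ) * B4Sect5Proof.latticeConst d t)
              (min a (8 * min (a * (1 - ((L : ℝ) ^ 2)⁻¹) / (8 * d + 2 * μ0sq)) (1 / 4)) / (L : ℝ) ^ 2)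
              (a * ((L : ℝ) ^ 2)⁻¹ * Real.exp (δ * ((L : ℝ) - 1)) + a +
                a ^ 2 * (2 / min 8 (a * (1 - ((L : ℝ) ^ 2)⁻¹)) * Real.exp δ)) δ) with hcV
  set rV : ℝ := min (dSt (fun t => (nCol d : ℝ) * B4Sect5Proof.latticeConst d t) (min a 8 / (L : ℝ) ^ 2)
              (a * ((L : ℝ) ^ 2)⁻¹ * Real.exp (δ * ((L : ℝ) - 1)) + (4 * d + μ0sq) * Real.exp δ) δ)
            (dSt (fun t => (nCol d : ℝ) * B4Sect5Proof.latticeConst d t)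
              (min a (8 * min (a * (1 - ((L : ℝ) ^ 2)⁻¹) / (8 * d + 2 * μ0sq)) (1 / 4)) / (L : ℝ) ^ 2)
              (a * ((L : ℝ) ^ 2)⁻¹ * Real.exp (δ * ((L : ℝ) - 1)) + a +
                a ^ 2 * (2 / min 8 (a * (1 - ((L : ℝ) ^ 2)⁻¹)) * Real.exp δ)) δ) with hrV
  have hcV0 : 0 ≤ cV := by
    rw [hcV]; exact mul_nonneg (Nat.cast_nonneg d) ((cSt_pos _ _ _ hγ0).le.trans (le_max_left _ _))
  have hrV0 : 0 < rV := by
    rw [hrV]; exact lt_min (dSt_pos hKd hγ0 hκ0 hδ0) (dSt_pos hKd hγ1 hκ1 hδ0)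
  refine ⟨K₀min, cA, fun K₀ => max cV ((N : ℝ) * c₁ K₀), fun K₀ => min rV (δ₁ K₀),
    fun K₀ => ⟨(hpos K₀).1, le_max_of_le_left hcV0, lt_min hrV0 (hpos K₀).2.2⟩, ?_⟩
  intro K₀ hK₀ P S hPd hPL hK₀M k hk1 hk hN3 hs r hr A hA qmax coef n _ A₀ δ₀ hA₀ hδ₀ h358
  have H' := H K₀ hK₀ P S hPd hPL hK₀M hk1 hk hN3 hs hr A hA
  subst hPd; subst hPL
  have hPL1 : 1 < P.L := hL.2
  have hLr : (1 : ℝ) < (P.L : ℝ) := by exact_mod_cast hPL1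
  have hc₁ : 0 ≤ c₁ K₀ := (hpos K₀).2.1.le
  have hNc : 0 ≤ (N : ℝ) * c₁ K₀ := mul_nonneg (Nat.cast_nonneg N) hc₁
  have hsk : 0 ≤ P.mesh k ^ (-((P.d : ℝ) - 2)) := Real.rpow_nonneg (P.mesh_pos k).le _
  refine abs_cumulantOf_rv357_le_of_ineq234 C Finset.univ (bgVec (P := P) μ0sq a k A) hμ hmsq ha hLr hk.le qmax coef hA₀ hδ₀
    hcV0 (lt_min hrV0 (hpos K₀).2.2) h358 (fun b b' => ?_) (fun y y' j j' => ?_)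
  · -- vector factor: zero-field (2.34) at level k (`pairing234A_zeroField`), constants weakened to the common pair
    have hδ' : (4 * (P.d : ℝ) + 4 * a) * δ ≤ min 8 (a * (1 - ((P.L : ℝ) ^ 2)⁻¹)) := hδ
    have h := pairing234A_zeroField (P := P) ha hPL1 hμ hk hs hδ0 hδ' b b'
    have ht : 0 ≤ (HiggsLattice.Site.tdist b.src b'.src : ℝ) := Nat.cast_nonneg _
    have hcVP : (P.d : ℝ)
        * max (cSt (profile P P.d) (min a 8 / (P.L : ℝ) ^ 2)
                (a * ((P.L : ℝ) ^ 2)⁻¹ * Real.exp (δ * ((P.L : ℝ) - 1)) + (4 * P.d + μ0sq) * Real.exp δ) δ)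
              (cSt (profile P P.d) (min a (8 * B2Prop31ZeroFieldConcrete.gamma0 P a μ0sq) / (P.L : ℝ) ^ 2)
                (a * ((P.L : ℝ) ^ 2)⁻¹ * Real.exp (δ * ((P.L : ℝ) - 1)) + a +
                  a ^ 2 * (2 / min 8 (a * (1 - ((P.L : ℝ) ^ 2)⁻¹)) * Real.exp δ)) δ) = cV := by
      rw [hcV]; rfl
    have hrVP : min (dSt (profile P P.d) (min a 8 / (P.L : ℝ) ^ 2)
                (a * ((P.L : ℝ) ^ 2)⁻¹ * Real.exp (δ * ((P.L : ℝ) - 1)) + (4 * P.d + μ0sq) * Real.exp δ) δ)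
              (dSt (profile P P.d) (min a (8 * B2Prop31ZeroFieldConcrete.gamma0 P a μ0sq) / (P.L : ℝ) ^ 2)
                (a * ((P.L : ℝ) ^ 2)⁻¹ * Real.exp (δ * ((P.L : ℝ) - 1)) + a +
                  a ^ 2 * (2 / min 8 (a * (1 - ((P.L : ℝ) ^ 2)⁻¹)) * Real.exp δ)) δ) = rV := by
      rw [hrV]; rfl
    rw [hcVP, hrVP] at h
    calc _ ≤ _ := h
      _ = 1 * cV * P.mesh k ^ (-((P.d : ℝ) - 2)) * Real.exp (-(rV * (HiggsLattice.Site.tdist b.src b'.src : ℝ))) := by ring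
      _ ≤ 1 * cV * P.mesh k ^ (-((P.d : ℝ) - 2))
            * Real.exp (-(min rV (δ₁ K₀) * (HiggsLattice.Site.tdist b.src b'.src : ℝ))) :=
          weaken_decay zero_le_one hsk le_rfl hcV0 (min_le_left _ _) ht
      _ = _ := by ring
  · -- scalar factor: r14 g13's (2.34) at the (3.29) background, entrywise, through §1
    have hm : 0 < P.mesh k := P.mesh_pos k
    have hmat : ∀ i i' : Ix N,
        |mat (condCov232 C Finset.univ (bgVec (P := P) μ0sq a k A) msq a k (Finset.univ : Finset (HiggsLattice.Site P k)))
            (y, i) (y', i')| ≤ P.mesh k ^ 2 * c₁ K₀ * Real.exp (-(δ₁ K₀ * (HiggsLattice.Site.tdist y y' : ℝ))) :=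
      fun i i' => (H' Finset.univ (p := (y, i)) (q := (y', i')) (Finset.mem_univ _) (Finset.mem_univ _)).1
    have h := abs_siteInner_siteDelta_le_of_mat _ y y' (by positivity) hmat j j'
    have ht : 0 ≤ (HiggsLattice.Site.tdist y y' : ℝ) := Nat.cast_nonneg _
    calc _ ≤ _ := h
      _ = 1 * ((N : ℝ) * c₁ K₀) * ((P.mesh k ^ P.d)⁻¹ * P.mesh k ^ 2)
            * Real.exp (-(δ₁ K₀ * (HiggsLattice.Site.tdist y y' : ℝ))) := by ring
      _ = 1 * ((N : ℝ) * c₁ K₀) * P.mesh k ^ (-((P.d : ℝ) - 2)) * Real.exp (-(δ₁ K₀ * (HiggsLattice.Site.tdist y y' : ℝ))) := by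
          rw [mesh_pow_inv_mul_sq]
      _ ≤ 1 * ((N : ℝ) * c₁ K₀) * P.mesh k ^ (-((P.d : ℝ) - 2))
            * Real.exp (-(min rV (δ₁ K₀) * (HiggsLattice.Site.tdist y y' : ℝ))) :=
          weaken_decay zero_le_one hsk le_rfl hNc (min_le_right _ _) ht
      _ = _ := by ring

end Background

/-! ## §6 Levels `1 ≤ k < K` at a general regular background on the whole torus (Prop. 2.3's own class, `Ω = T_ε`) -/

section RegularTorus

open B4Sect5Torus (cSt dSt cSt_pos dSt_pos)
open B1Ineq234Concrete (profile nCol)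
open B1Eq211ZeroFieldTorus (Shape)
open B1TorusCubeCover (half)
open B1Props21to23RegularTorus (ineq234_236_regular_torus)
open B1Prop32InteractionBound (Leg)
open B1Ineq358TreeDecaySum (diam)
open Literature.Probability.LatticeModels (cumulantOf)
open B10Eq24Cumulant (nmoment)
open B1Eq323ConnectedGraphBound (connConst)
open B1Eq357FluctuationPolynomial (law356 rv357)
open B1Eq323DisplayedCumulantBound (abs_cumulantOf_rv357_le_of_ineq234)

/-- **(3.23) FOR THE DISPLAYED `V^{(k)}` AT A GENERAL REGULAR BACKGROUND ON THE WHOLE TORUS, LEVELS `1 ≤ k < K`, CUBE SUB-FAMILY, NO PROPAGATOR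
HYPOTHESIS** — Prop. 2.3's own class *"If a configuration A is regular on Ω …"* with `Ω = T_ε` (existential shape of r14's `B1Props21to23RegularTorus`):
for odd `L > 1`, `a, μ₀², m² > 0`, `N`, `(e, q)` there are `K₀min` and `t_A : ℕ → ℝ_{>0}`, `c, δ₁ : ℕ → ℝ` (`c ≥ 0`, `δ₁ > 0`; functions of
`(d, N, L, a, μ₀², m², e)` and `K₀` only) such that for `K₀ ≥ K₀min`, on every torus of the sub-family with `K₀ ∣ M`, at every level `1 ≤ k < K` with
`3·L^kK₀ ≤ |T_ε|_μ` and `L^kε ≤ 1`, for every background `B` on `T_ε` that is `δ`-regular (`|B(⟨z+e_ν,μ⟩) − B(⟨z,μ⟩)| ≤ δ`) with `L^kδ·|e| ≤ t_A(K₀)`,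
every `n ≥ 1` and every displayed `V^{(k)}` obeying (3.58) with `(A₀, δ₀)`:
`|⟨(V^{(k)})ⁿ⟩^T| ≤ connConst(d, N+d, n, q_max, c(K₀), δ₀, δ₁(K₀))·A₀ⁿ·|T^{(k)}|` for the law `dμ_{C^{(k)}}(A′)dμ_{C^{(k)}(B)}(φ′)` — r14's
`abs_cumulantOf_rv357_le_of_ineq234` with `h234φ` DISCHARGED from r14's `B1Props21to23RegularTorus.ineq234_236_regular_torus` and `h234A` from
`pairing234A_zeroField` (rate `min{8,a(1−L^{−2})}/(4d+4a)`). [cite: Balaban1982Higgs1, (3.23) p.616; Prop. 2.3 (2.34) p.611; Prop. 2.1 (2.23) p.610; Prop. 3.2 (3.58) p.622] -/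
theorem abs_cumulantOf_rv357_le_regular_torus (d L : ℕ) (hL : Odd L ∧ 1 < L) {a : ℝ} (ha : 0 < a) {μ0sq msq : ℝ}
    (hμ : 0 < μ0sq) (hmsq : 0 < msq) (N : ℕ) (C : ChargeData N) :
    ∃ K₀min : ℕ, ∃ tA c δ₁ : ℕ → ℝ, (∀ K₀, 0 < tA K₀ ∧ 0 ≤ c K₀ ∧ 0 < δ₁ K₀) ∧
      ∀ K₀ : ℕ, K₀min ≤ K₀ →
      ∀ (P : HiggsLattice.Params) (_S : Shape P), P.d = d → P.L = L → K₀ ∣ P.M →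
      ∀ {k : ℕ}, 1 ≤ k → k < P.K → (∀ μ, 3 * half P k K₀ ≤ P.sitesPerDir 0 μ) → P.mesh k ≤ 1 →
      ∀ (B : HiggsLattice.VecField P 0) {δB : ℝ}, 0 ≤ δB →
        (∀ (z : HiggsLattice.Site P 0) (μ ν : Fin P.d), |B ⟨z.shift ν, μ⟩ - B ⟨z, μ⟩| ≤ δB) →
        (P.L : ℝ) ^ k * δB * |C.e| ≤ tA K₀ →
        ∀ (qmax : ℕ) (coef : (q : ℕ) → (Fin q → HiggsLattice.Site P k) → (Fin q → Leg N P.d) → ℝ) (n : ℕ) [NeZero n]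
          (A₀ δ₀ : ℝ), 0 ≤ A₀ → 0 < δ₀ →
          (∀ q, q ≤ qmax → ∀ (z : Fin q → HiggsLattice.Site P k) (κ : Fin q → Leg N P.d),
              |coef q z κ| ≤ A₀ * Real.exp (-(δ₀ * (diam z : ℝ)))) →
          |cumulantOf (nmoment (rv357 k qmax coef) (law356 C Finset.univ B μ0sq msq a k)) n|
            ≤ connConst d (N + d) n qmax (c K₀) δ₀ (δ₁ K₀) * A₀ ^ n * Fintype.card (HiggsLattice.Site P k) := by
  obtain ⟨K₀min, cA, c₁, δ₁, hpos, H⟩ := ineq234_236_regular_torus d L hL ha hmsq N C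
  -- the admissible rate of the zero-field vector factor and the P-free spelling of its constants (`pairing234A_zeroField`)
  have hL1 : (1 : ℝ) < (L : ℝ) := by exact_mod_cast hL.2
  have hL0 : (0 : ℝ) < (L : ℝ) := by linarith
  have hLi : ((L : ℝ) ^ 2)⁻¹ < 1 := inv_lt_one_of_one_lt₀ (by nlinarith)
  have hγZ : 0 < min 8 (a * (1 - ((L : ℝ) ^ 2)⁻¹)) := lt_min (by norm_num) (mul_pos ha (by linarith))
  set δ : ℝ := min 8 (a * (1 - ((L : ℝ) ^ 2)⁻¹)) / (4 * d + 4 * a) with hδdef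
  have hden : 0 < 4 * (d : ℝ) + 4 * a := by positivity
  have hδ0 : 0 < δ := div_pos hγZ hden
  have hδ : (4 * (d : ℝ) + 4 * a) * δ ≤ min 8 (a * (1 - ((L : ℝ) ^ 2)⁻¹)) := by
    rw [hδdef, mul_div_cancel₀ _ hden.ne']
  have hγ0 : 0 < min a 8 / (L : ℝ) ^ 2 := div_pos (lt_min ha (by norm_num)) (pow_pos hL0 2)
  have hg : 0 < min (a * (1 - ((L : ℝ) ^ 2)⁻¹) / (8 * d + 2 * μ0sq)) (1 / 4) :=
    lt_min (div_pos (mul_pos ha (by linarith)) (by positivity)) (by norm_num)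
  have hγ1 : 0 < min a (8 * min (a * (1 - ((L : ℝ) ^ 2)⁻¹) / (8 * d + 2 * μ0sq)) (1 / 4)) / (L : ℝ) ^ 2 :=
    div_pos (lt_min ha (by linarith)) (pow_pos hL0 2)
  have hκ0 : 0 ≤ a * ((L : ℝ) ^ 2)⁻¹ * Real.exp (δ * ((L : ℝ) - 1)) + (4 * d + μ0sq) * Real.exp δ := by positivity
  have hκ1 : 0 ≤ a * ((L : ℝ) ^ 2)⁻¹ * Real.exp (δ * ((L : ℝ) - 1)) + a +
      a ^ 2 * (2 / min 8 (a * (1 - ((L : ℝ) ^ 2)⁻¹)) * Real.exp δ) := by positivity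
  have hKd : ∀ t : ℝ, 0 < t → 0 ≤ (nCol d : ℝ) * B4Sect5Proof.latticeConst d t := B4Sect5Torus.profile_nonneg d (nCol d)
  set cV : ℝ := (d : ℝ)
      * max (cSt (fun t => (nCol d : ℝ) * B4Sect5Proof.latticeConst d t) (min a 8 / (L : ℝ) ^ 2)
              (a * ((L : ℝ) ^ 2)⁻¹ * Real.exp (δ * ((L : ℝ) - 1)) + (4 * d + μ0sq) * Real.exp δ) δ)
            (cSt (fun t => (nCol d : ℝ) * B4Sect5Proof.latticeConst d t)
              (min a (8 * min (a * (1 - ((L : ℝ) ^ 2)⁻¹) / (8 * d + 2 * μ0sq)) (1 / 4)) / (L : ℝ) ^ 2)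
              (a * ((L : ℝ) ^ 2)⁻¹ * Real.exp (δ * ((L : ℝ) - 1)) + a +
                a ^ 2 * (2 / min 8 (a * (1 - ((L : ℝ) ^ 2)⁻¹)) * Real.exp δ)) δ) with hcV
  set rV : ℝ := min (dSt (fun t => (nCol d : ℝ) * B4Sect5Proof.latticeConst d t) (min a 8 / (L : ℝ) ^ 2)
              (a * ((L : ℝ) ^ 2)⁻¹ * Real.exp (δ * ((L : ℝ) - 1)) + (4 * d + μ0sq) * Real.exp δ) δ)
            (dSt (fun t => (nCol d : ℝ) * B4Sect5Proof.latticeConst d t)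
              (min a (8 * min (a * (1 - ((L : ℝ) ^ 2)⁻¹) / (8 * d + 2 * μ0sq)) (1 / 4)) / (L : ℝ) ^ 2)
              (a * ((L : ℝ) ^ 2)⁻¹ * Real.exp (δ * ((L : ℝ) - 1)) + a +
                a ^ 2 * (2 / min 8 (a * (1 - ((L : ℝ) ^ 2)⁻¹)) * Real.exp δ)) δ) with hrV
  have hcV0 : 0 ≤ cV := by
    rw [hcV]; exact mul_nonneg (Nat.cast_nonneg d) ((cSt_pos _ _ _ hγ0).le.trans (le_max_left _ _))
  have hrV0 : 0 < rV := by
    rw [hrV]; exact lt_min (dSt_pos hKd hγ0 hκ0 hδ0) (dSt_pos hKd hγ1 hκ1 hδ0)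
  refine ⟨K₀min, cA, fun K₀ => max cV ((N : ℝ) * c₁ K₀), fun K₀ => min rV (δ₁ K₀),
    fun K₀ => ⟨(hpos K₀).1, le_max_of_le_left hcV0, lt_min hrV0 (hpos K₀).2.2⟩, ?_⟩
  intro K₀ hK₀ P S hPd hPL hK₀M k hk1 hk hN3 hs B δB hδB hreg htA qmax coef n _ A₀ δ₀ hA₀ hδ₀ h358
  have H' := H K₀ hK₀ P S hPd hPL hK₀M hk1 hk hN3 hs B hδB hreg htA
  subst hPd; subst hPL
  have hPL1 : 1 < P.L := hL.2
  have hLr : (1 : ℝ) < (P.L : ℝ) := by exact_mod_cast hPL1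
  have hc₁ : 0 ≤ c₁ K₀ := (hpos K₀).2.1.le
  have hNc : 0 ≤ (N : ℝ) * c₁ K₀ := mul_nonneg (Nat.cast_nonneg N) hc₁
  have hsk : 0 ≤ P.mesh k ^ (-((P.d : ℝ) - 2)) := Real.rpow_nonneg (P.mesh_pos k).le _
  refine abs_cumulantOf_rv357_le_of_ineq234 C Finset.univ B hμ hmsq ha hLr hk.le qmax coef hA₀ hδ₀
    hcV0 (lt_min hrV0 (hpos K₀).2.2) h358 (fun b b' => ?_) (fun y y' j j' => ?_)
  · -- vector factor: zero-field (2.34) at level k (`pairing234A_zeroField`), constants weakened to the common pair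
    have hδ' : (4 * (P.d : ℝ) + 4 * a) * δ ≤ min 8 (a * (1 - ((P.L : ℝ) ^ 2)⁻¹)) := hδ
    have h := pairing234A_zeroField (P := P) ha hPL1 hμ hk hs hδ0 hδ' b b'
    have ht : 0 ≤ (HiggsLattice.Site.tdist b.src b'.src : ℝ) := Nat.cast_nonneg _
    have hcVP : (P.d : ℝ)
        * max (cSt (profile P P.d) (min a 8 / (P.L : ℝ) ^ 2)
                (a * ((P.L : ℝ) ^ 2)⁻¹ * Real.exp (δ * ((P.L : ℝ) - 1)) + (4 * P.d + μ0sq) * Real.exp δ) δ)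
              (cSt (profile P P.d) (min a (8 * B2Prop31ZeroFieldConcrete.gamma0 P a μ0sq) / (P.L : ℝ) ^ 2)
                (a * ((P.L : ℝ) ^ 2)⁻¹ * Real.exp (δ * ((P.L : ℝ) - 1)) + a +
                  a ^ 2 * (2 / min 8 (a * (1 - ((P.L : ℝ) ^ 2)⁻¹)) * Real.exp δ)) δ) = cV := by
      rw [hcV]; rfl
    have hrVP : min (dSt (profile P P.d) (min a 8 / (P.L : ℝ) ^ 2)
                (a * ((P.L : ℝ) ^ 2)⁻¹ * Real.exp (δ * ((P.L : ℝ) - 1)) + (4 * P.d + μ0sq) * Real.exp δ) δ)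
              (dSt (profile P P.d) (min a (8 * B2Prop31ZeroFieldConcrete.gamma0 P a μ0sq) / (P.L : ℝ) ^ 2)
                (a * ((P.L : ℝ) ^ 2)⁻¹ * Real.exp (δ * ((P.L : ℝ) - 1)) + a +
                  a ^ 2 * (2 / min 8 (a * (1 - ((P.L : ℝ) ^ 2)⁻¹)) * Real.exp δ)) δ) = rV := by
      rw [hrV]; rfl
    rw [hcVP, hrVP] at h
    calc _ ≤ _ := h
      _ = 1 * cV * P.mesh k ^ (-((P.d : ℝ) - 2)) * Real.exp (-(rV * (HiggsLattice.Site.tdist b.src b'.src : ℝ))) := by ring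
      _ ≤ 1 * cV * P.mesh k ^ (-((P.d : ℝ) - 2))
            * Real.exp (-(min rV (δ₁ K₀) * (HiggsLattice.Site.tdist b.src b'.src : ℝ))) :=
          weaken_decay zero_le_one hsk le_rfl hcV0 (min_le_left _ _) ht
      _ = _ := by ring
  · -- scalar factor: r14's (2.34) at a general regular background, entrywise, through §1
    have hm : 0 < P.mesh k := P.mesh_pos k
    have hmat : ∀ i i' : Ix N,
        |mat (condCov232 C Finset.univ B msq a k (Finset.univ : Finset (HiggsLattice.Site P k)))
            (y, i) (y', i')| ≤ P.mesh k ^ 2 * c₁ K₀ * Real.exp (-(δ₁ K₀ * (HiggsLattice.Site.tdist y y' : ℝ))) :=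
      fun i i' => (H' Finset.univ (p := (y, i)) (q := (y', i')) (Finset.mem_univ _) (Finset.mem_univ _)).1
    have h := abs_siteInner_siteDelta_le_of_mat _ y y' (by positivity) hmat j j'
    have ht : 0 ≤ (HiggsLattice.Site.tdist y y' : ℝ) := Nat.cast_nonneg _
    calc _ ≤ _ := h
      _ = 1 * ((N : ℝ) * c₁ K₀) * ((P.mesh k ^ P.d)⁻¹ * P.mesh k ^ 2)
            * Real.exp (-(δ₁ K₀ * (HiggsLattice.Site.tdist y y' : ℝ))) := by ring
      _ = 1 * ((N : ℝ) * c₁ K₀) * P.mesh k ^ (-((P.d : ℝ) - 2)) * Real.exp (-(δ₁ K₀ * (HiggsLattice.Site.tdist y y' : ℝ))) := by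
          rw [mesh_pow_inv_mul_sq]
      _ ≤ 1 * ((N : ℝ) * c₁ K₀) * P.mesh k ^ (-((P.d : ℝ) - 2))
            * Real.exp (-(min rV (δ₁ K₀) * (HiggsLattice.Site.tdist y y' : ℝ))) :=
          weaken_decay zero_le_one hsk le_rfl hNc (min_le_right _ _) ht
      _ = _ := by ring

end RegularTorus

end

end Literature.MathematicalPhysics.QuantumFieldTheory.Balaban1983to89.B1Eq323DisplayedCumulantBoundModels
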